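import Literature.Probability.LatticeModels.SquareTilingHoloLimit
import Literature.Probability.LatticeModels.SquareTilingUniformization
import Literature.Analysis.Complex.HolomorphicAreaMultiplicity
import HarnessLib

/-!
# Square tilings of lattice domains, VI: boundary values of the conjugates and
# [GP19] Corollary 4.15

Topic: Probability / LatticeModels. Last file of the proof of [GP19] Corollary 4.15
(A. Georgakopoulos, C. Panagiotis, *Convergence of square tilings to the Riemann map*,
arXiv:1910.06886), the convergence `R^eff_n → d_Ω(T, B)` of the effective resistances of the
lattice domains `Ω_n` of a conformal rectangle along the dyadic meshes
(`GeorgakopoulosPanagiotis2019_cor415_holds`, discharging the named fact of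
`SquareTilingModulus.lean`). The upper half `lim sup ≤` is Theorem 4.6 for the potentials
(`SquareTilingModulusLimsup.lean`); the lower half `lim inf ≥`, in [GP19] obtained from the planar
dual network (`h'(l) = 0`, `h'(r) = I*`, §3), is proved here on `ℤ²` from the conjugates of
`SquareTilingConjugate.lean`:

* §B1 exits of the dual component near a boundary point (`exists_exit_near`);
* §B2 **boundary values of the limit `u` of the conjugates** (`exists_boundary_value`): at every
  boundary point `q` far from the arcs `0 ∪ 2` the common virtual exit value `c_n` near `q`
  (`exitVal_eq_exitVal`) converges and `u → lim c_n` at `q`, by the weak Beurling estimate for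
  the conjugate (`abs_dualPot_sub_exitVal_le`, the dual form of [GP19] Lemma 4.8);
* §B3 the current out of `T_n` is `𝒞(T_n ↔ B_n)` (`sum_divAt_eq_toReal_conductance`, summation
  by parts);
* §B4–§B6 uniqueness of boundary limits, locally constant functions on intervals, conformal
  invariance of the Dirichlet integral (`lintegral_deriv_comp_sq_eq`) and the **rectangle energy
  inequality** `(u₁ - u₀)² a / b ≤ ∫∫_{(0,a)×(0,b)} ‖F'‖²` for `F` holomorphic with `Re F → u₀, u₁`
  on the horizontal sides (`ofReal_sq_sub_mul_div_le_lintegral_rect`, length–area);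
* §B7 **the lower bound** (`le_inv_extremalDistance_of_subseq`): with the uniformizing rectangle
  `Ψ : (0,a)×(0,b) → Ω` (`exists_rect_uniformizer`), the cross and the flux across the crosscut
  (`exists_cross_data`, `exists_exits_flux_eq`: the jump of the boundary values of `u` between
  the open arcs `1` and `3` is `±lim 𝒞_n = ±I`), and the holomorphic limit `f = u + iv` with
  `∫∫_Ω ‖f'‖² ≤ I` (`exists_holomorphic_limit`): `I² a/b ≤ I`, while `d_Ω(arc 0, arc 2) ≤ a/b`
  (`extremalDistance_arc_le`), so `I ≤ d_Ω(T,B)⁻¹`;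
* §B8 Corollary 4.15.

Everything here is proved; no named fact is introduced.

## References

* [GeorgakopoulosPanagiotis2019] A. Georgakopoulos, C. Panagiotis, *Convergence of square tilings
  to the Riemann map*, arXiv:1910.06886 (2019), §3, Lemma 4.8, Theorem 4.6, Corollary 4.15 (p. 16).
-/

noncomputable section

namespace Literature.Probability.LatticeModels

open _root_.Filter _root_.Set _root_.Metric SimpleGraph
open scoped ENNReal NNReal _root_.Topology
open Literature.Probability.Percolation

namespace SquareTiling

/-! ### §B1. Exits near a boundary point -/

section ExitsNear

open WeakBeurling

variable {δ : ℝ}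

/-- **An exit near a boundary point.** From a square `x₀` of the component of the base whose mesh
point is within `R₀` of a boundary point `q`, following the shadow of the segment to `q` gives an
exit `(p₁, n₁)` of the component whose two squares lie within `R₀ + 3δ` of `q`, the outer one
containing a frontier point. [folklore] -/
theorem exists_exit_near (R : RandomPlanarGeometry.ConformalRectangle) (hδ : 0 < δ) {p₀ x₀ : Site 2}
    (hp₀ : IsInnerSq R.carrier δ p₀) (hx₀ : (dualGraph R.carrier δ).Reachable p₀ x₀) {q : ℂ}
    (hq : q ∈ frontier R.carrier) {R₀ : ℝ} (hR₀ : dist (meshPoint δ x₀) q ≤ R₀) :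
    ∃ p₁ n₁ : Site 2, (dualGraph R.carrier δ).Reachable p₀ p₁ ∧ (zdGraph 2).Adj p₁ n₁ ∧
      ¬ (dualGraph R.carrier δ).Reachable p₀ n₁ ∧
      (∃ j ∈ closedSq δ n₁, j ∈ frontier R.carrier) ∧
      (∀ w ∈ closedSq δ p₁, dist w q ≤ R₀ + 3 * δ) ∧ (∀ w ∈ closedSq δ n₁, dist w q ≤ R₀ + 3 * δ) := by
  have hqΩ : q ∉ R.carrier := fun h => Set.disjoint_left.1 R.disjoint_carrier_frontier h hq
  -- the shadow of the segment from the mesh point of `x₀` to `q`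
  obtain ⟨hLc, hL0, hL1, hLim⟩ := lineMap_props (meshPoint δ x₀) q
  obtain ⟨ω, -, hωs⟩ := exists_dualWalk_of_path hδ zero_le_one hLc (P := x₀) (P' := floorSq δ q)
    (by show AffineMap.lineMap _ _ (0 : ℝ) ∈ _; rw [hL0]; exact meshPoint_mem_closedSq hδ.le (Or.inl rfl) (Or.inl rfl))
    (by show AffineMap.lineMap _ _ (1 : ℝ) ∈ _; rw [hL1]; exact mem_closedSq_floorSq hδ _)
  have hreach_inner : ∀ {y : Site 2}, (dualGraph R.carrier δ).Reachable p₀ y → IsInnerSq R.carrier δ y := fun hy => by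
    obtain ⟨W⟩ := hy; exact isInnerSq_of_mem_support' hp₀ W (Walk.end_mem_support _)
  have hend : ¬ (dualGraph R.carrier δ).Reachable p₀ (floorSq δ q) := fun h =>
    not_isInnerSq_of_mem_closedSq R hδ (mem_closedSq_floorSq hδ q) hqΩ (hreach_inner h)
  obtain ⟨p₁, n₁, hadj, w₁, w₂, hdec, hw₁F, hn₁F, hn₁supp, hw₁supp⟩ := exists_exit_decomp ω hx₀ hend
  have hp₁F : (dualGraph R.carrier δ).Reachable p₀ p₁ := hw₁F _ (Walk.end_mem_support _)
  have hnear : ∀ y ∈ ω.support, ∀ w ∈ closedSq δ y, dist w q ≤ R₀ + 3 * δ := by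
    intro y hy w hw
    obtain ⟨v, hv, hvy⟩ := near_of_shadow hωs hy
    rw [hLim] at hv
    have h1 : dist v q ≤ dist (meshPoint δ x₀) q := by
      have := (convex_closedBall q (dist (meshPoint δ x₀) q)).segment_subset (mem_closedBall.2 le_rfl)
        (mem_closedBall_self dist_nonneg) hv
      exact mem_closedBall.1 this
    have h2 := dist_le_of_mem_closedSq hw hvy
    linarith [dist_triangle w v q]
  refine ⟨p₁, n₁, hp₁F, hadj, hn₁F, ?_, hnear p₁ (hw₁supp _ (Walk.end_mem_support _)), hnear n₁ hn₁supp⟩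
  exact exists_mem_frontier_of_adj_not_isInnerSq R hδ (hreach_inner hp₁F) hadj fun hI =>
    hn₁F (hp₁F.trans (dualGraph_adj_iff.2 ⟨hadj, hreach_inner hp₁F, hI⟩).reachable)

end ExitsNear


/-! ### §B2. Boundary values of the limit of the conjugates -/

section BoundaryValues

open WeakBeurling


/-- Lattice points whose mesh points are within `m δ` lie in each other's `m`-boxes. [folklore] -/
theorem mem_sqBox_of_dist_le {δ : ℝ} (hδ : 0 < δ) {x y : Site 2} {m : ℤ}
    (h : dist (meshPoint δ x) (meshPoint δ y) ≤ m * δ) : x ∈ WeakBeurling.sqBox y m := by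
  rw [WeakBeurling.mem_sqBox]
  have hre : |δ * ((x 0 : ℝ) - y 0)| ≤ m * δ := by
    have := Complex.abs_re_le_norm (meshPoint δ x - meshPoint δ y)
    rw [Complex.dist_eq] at h
    simp only [Complex.sub_re, meshPoint_re, ← mul_sub] at this
    exact this.trans h
  have him : |δ * ((x 1 : ℝ) - y 1)| ≤ m * δ := by
    have := Complex.abs_im_le_norm (meshPoint δ x - meshPoint δ y)
    rw [Complex.dist_eq] at h
    simp only [Complex.sub_im, meshPoint_im, ← mul_sub] at this
    exact this.trans h
  rw [abs_mul, abs_of_pos hδ, mul_comm] at hre him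
  have hre' : |((x 0 : ℝ) - y 0)| ≤ m := le_of_mul_le_mul_right hre hδ
  have him' : |((x 1 : ℝ) - y 1)| ≤ m := le_of_mul_le_mul_right him hδ
  constructor
  · have : ((|x 0 - y 0| : ℤ) : ℝ) ≤ m := by push_cast; exact hre'
    exact_mod_cast this
  · have : ((|x 1 - y 1| : ℤ) : ℝ) ≤ m := by push_cast; exact him'
    exact_mod_cast this

set_option maxHeartbeats 1600000 in
open Classical in
/-- **Boundary values of the conjugates' limit.** Setting: meshes `δ_n → 0`, potentials `h_n`
(values in `[0,1]`, harmonic off `T_n ∪ B_n`, real energies `≤ E`), conjugates `h'_n` based at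
the square of `c⋆ = xs + ys i ∈ Ω`, converging locally uniformly on `Ω` to `u`. For every `D > 0`
there is a radius `r_a > 0` such that for every boundary point `q = boundary s₀` at distance
`≥ D` from the arcs `0 ∪ 2`: the common virtual value `c_n` of the exits near `q`
(`exitVal_eq_exitVal`) converges to a number `U`, `u(w) → U` as `w → q` in `Ω` (by the weak
Beurling estimate for the conjugate, `abs_dualPot_sub_exitVal_le`), every exit at level `n`
whose outer square contains a frontier point within `r_a` of `q` has virtual value `c_n`, and
some such exit lies within `r_a / 2` of `q`. [cite: GeorgakopoulosPanagiotis2019, §3 and Lemma 4.8 (dual form)] -/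
theorem exists_boundary_value (R : RandomPlanarGeometry.ConformalRectangle) (h0 : (0 : ℂ) ∈ R.carrier)
    {δs : ℕ → ℝ} (hδ : ∀ n, 0 < δs n) (hδ0 : Tendsto δs atTop (𝓝 0)) {h : ℕ → Site 2 → ℝ}
    (h01 : ∀ n x, h n x ∈ Icc (0 : ℝ) 1)
    (hharm : ∀ n x, x ∉ arcVertices R.carrier (δs n) (R.arc 0) → x ∉ arcVertices R.carrier (δs n) (R.arc 2) →
      ∑ y ∈ ((zdGraph 2).neighborFinset x).filter (fun y => (domainGraph R.carrier (δs n)).Adj x y), (h n y - h n x) = 0)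
    {E : ℝ} (hEn : ∀ᶠ n in atTop, ∑ e ∈ (edgeSet_domainGraph_finite R.isBounded (hδ n)).toFinset, sqIncr (h n) e ≤ E)
    {xs ys : ℝ} (hc : (⟨xs, ys⟩ : ℂ) ∈ R.carrier) {u : ℂ → ℝ}
    (hconv : ∀ z ∈ R.carrier, ∃ s > 0, TendstoUniformlyOn
      (fun n w => dualPot R.carrier (δs n) (h n) ![⌊xs / δs n⌋, ⌊ys / δs n⌋] (nearestSite (δs n) w)) u atTop (ball z s))
    {D : ℝ} (hD : 0 < D) :
    ∃ ra > 0, ∀ s₀ : ℝ, (∀ y ∈ R.arc 0 ∪ R.arc 2, D ≤ dist (R.boundary s₀) y) →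
      ∃ (U : ℝ) (c : ℕ → ℝ), Tendsto c atTop (𝓝 U) ∧
        (∀ η > 0, ∃ r > 0, ∀ w ∈ R.carrier, dist w (R.boundary s₀) < r → |u w - U| ≤ η) ∧
        (∀ᶠ n in atTop, ∀ p p' : Site 2, (dualGraph R.carrier (δs n)).Reachable ![⌊xs / δs n⌋, ⌊ys / δs n⌋] p →
          (zdGraph 2).Adj p p' → ¬ (dualGraph R.carrier (δs n)).Reachable ![⌊xs / δs n⌋, ⌊ys / δs n⌋] p' →
          (∃ j ∈ closedSq (δs n) p', j ∈ frontier R.carrier ∧ dist j (R.boundary s₀) < ra) →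
          exitVal R.carrier (δs n) (h n) ![⌊xs / δs n⌋, ⌊ys / δs n⌋] p p' = c n) ∧
        (∀ᶠ n in atTop, ∃ p p' : Site 2, (dualGraph R.carrier (δs n)).Reachable ![⌊xs / δs n⌋, ⌊ys / δs n⌋] p ∧
          (zdGraph 2).Adj p p' ∧ ¬ (dualGraph R.carrier (δs n)).Reachable ![⌊xs / δs n⌋, ⌊ys / δs n⌋] p' ∧
          (∃ j ∈ closedSq (δs n) p', j ∈ frontier R.carrier ∧ dist j (R.boundary s₀) < ra / 2) ∧
          exitVal R.carrier (δs n) (h n) ![⌊xs / δs n⌋, ⌊ys / δs n⌋] p p' = c n) := by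
  have hΩo : IsOpen R.carrier := R.isOpen
  have hfrΩ : ∀ z ∈ frontier R.carrier, z ∉ R.carrier := fun z hz hzΩ =>
    Set.disjoint_left.1 R.disjoint_carrier_frontier hzΩ hz
  -- ### constants depending only on `D`
  set ε : ℝ := D / 2 with hε
  have hεpos : 0 < ε := by positivity
  obtain ⟨ρ₀, hρ₀, hULC₀⟩ := SquareTiling.JordanDomain.exists_joinedIn_exterior_diff_closedBall R.toJordanDomain hεpos
  set ρ : ℝ := min ρ₀ ε with hρ
  have hρpos : 0 < ρ := by positivity
  have hρε : ρ ≤ ε := min_le_right _ _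
  have hULC : ∀ (s₀ : ℝ) (e y : ℂ), e ∈ (closure R.carrier)ᶜ → y ∈ (closure R.carrier)ᶜ →
      ε ≤ dist e (R.boundary s₀) → ε ≤ dist y (R.boundary s₀) →
      JoinedIn ((closure R.carrier)ᶜ \ closedBall (R.boundary s₀) ρ) e y := by
    intro s₀ e y he hy hεe hεy
    exact (hULC₀ s₀ e y he hy hεe hεy).mono (sdiff_subset_sdiff_right (closedBall_subset_closedBall (min_le_left _ _)))
  obtain ⟨ra₀, hra₀, hshort⟩ := exists_short_boundary_arc R.toJordanDomain (half_pos hρpos)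
  set ra : ℝ := min ra₀ (ρ / 2) with hra
  have hrapos : 0 < ra := by positivity
  have hra₀' : ra ≤ ra₀ := min_le_left _ _
  have hraρ : ra ≤ ρ / 2 := min_le_right _ _
  refine ⟨ra, hrapos, fun s₀ hDq => ?_⟩
  set q := R.boundary s₀ with hq
  have hqfr : q ∈ frontier R.carrier := R.boundary_mem_frontier s₀
  -- the Beurling constant
  set KE : ℝ := (1 + 8 * Real.sqrt E) * beurlingConst with hKE
  have hKEpos : 0 < KE := by have := beurlingConst_pos; rw [hKE]; positivity
  -- a point of `Ω` very close to `q`, and the reachability of squares near it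
  obtain ⟨z', hz'Ω, hz'q⟩ : ∃ z' ∈ R.carrier, dist z' q < ra / 40 := by
    have : q ∈ closure R.carrier := frontier_subset_closure hqfr
    obtain ⟨z', hz', hd⟩ := Metric.mem_closure_iff.1 this (ra / 40) (by positivity)
    exact ⟨z', hz', by rwa [_root_.dist_comm]⟩
  obtain ⟨sr, hsr, δr, hδr, Hr⟩ := exists_forall_reachable_near R h0 hc hz'Ω
  -- ### eventually (in `n`): the discrete data at `q`
  -- the mesh is small
  have hsmall : ∀ᶠ n in atTop, δs n < min (min δr (ra / 200)) (min sr (ρ / 12)) :=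
    (tendsto_order.1 hδ0).2 _ (by positivity)
  -- notation
  set p₀ : ℕ → Site 2 := fun n => ![⌊xs / δs n⌋, ⌊ys / δs n⌋] with hp₀
  set Rb : ℕ → ℕ := fun n => ⌊ra / (5 * δs n)⌋₊ - 6 with hRb
  have hTsub : ∀ n, arcVertices R.carrier (δs n) (R.arc 0) ⊆ boundary R.carrier (δs n) := fun n x hx => hx.1
  have hBsub : ∀ n, arcVertices R.carrier (δs n) (R.arc 2) ⊆ boundary R.carrier (δs n) := fun n x hx => hx.1
  -- the good levels
  have hgood : ∀ᶠ n in atTop, IsInnerSq R.carrier (δs n) (p₀ n) ∧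
      (∀ x : Site 2, meshPoint (δs n) x ∈ ball z' sr → IsInnerSq R.carrier (δs n) x ∧ (dualGraph R.carrier (δs n)).Reachable (p₀ n) x) ∧
      δs n < ra / 200 ∧ δs n < ρ / 12 ∧ δs n < sr ∧
      ∑ e ∈ (edgeSet_domainGraph_finite R.isBounded (hδ n)).toFinset, sqIncr (h n) e ≤ E := by
    filter_upwards [hsmall, hEn] with n hn hEn'
    have h1 : δs n < δr := hn.trans_le ((min_le_left _ _).trans (min_le_left _ _))
    have h2 : δs n < ra / 200 := hn.trans_le ((min_le_left _ _).trans (min_le_right _ _))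
    have h3 : δs n < sr := hn.trans_le ((min_le_right _ _).trans (min_le_left _ _))
    have h4 : δs n < ρ / 12 := hn.trans_le ((min_le_right _ _).trans (min_le_right _ _))
    exact ⟨(Hr _ (hδ n) h1).1, (Hr _ (hδ n) h1).2, h2, h4, h3, hEn'⟩
  -- canonical exits at the good levels
  have hexit : ∀ n, (IsInnerSq R.carrier (δs n) (p₀ n) ∧
      (∀ x : Site 2, meshPoint (δs n) x ∈ ball z' sr → IsInnerSq R.carrier (δs n) x ∧ (dualGraph R.carrier (δs n)).Reachable (p₀ n) x) ∧
      δs n < ra / 200 ∧ δs n < ρ / 12 ∧ δs n < sr ∧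
      ∑ e ∈ (edgeSet_domainGraph_finite R.isBounded (hδ n)).toFinset, sqIncr (h n) e ≤ E) →
      ∃ p₁ n₁ : Site 2, (dualGraph R.carrier (δs n)).Reachable (p₀ n) p₁ ∧ (zdGraph 2).Adj p₁ n₁ ∧
        ¬ (dualGraph R.carrier (δs n)).Reachable (p₀ n) n₁ ∧
        (∃ j ∈ closedSq (δs n) n₁, j ∈ frontier R.carrier) ∧
        (∀ w ∈ closedSq (δs n) p₁, dist w q ≤ ra / 40 + δs n + 3 * δs n) ∧
        (∀ w ∈ closedSq (δs n) n₁, dist w q ≤ ra / 40 + δs n + 3 * δs n) := by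
    rintro n ⟨hp, Hr', -, -, hsr', -⟩
    have hx₀ : meshPoint (δs n) (nearestSite (δs n) z') ∈ ball z' sr := by
      rw [Metric.mem_ball]; exact (dist_meshPoint_nearestSite_le (hδ n) z').trans_lt hsr'
    refine exists_exit_near R (hδ n) hp (Hr' _ hx₀).2 hqfr ?_
    linarith [dist_triangle (meshPoint (δs n) (nearestSite (δs n) z')) z' q, dist_meshPoint_nearestSite_le (hδ n) z']
  choose! p₁ n₁ hp₁F hadj₁ hn₁F hj₁ hp₁near hn₁near using hexit
  set c : ℕ → ℝ := fun n => exitVal R.carrier (δs n) (h n) (p₀ n) (p₁ n) (n₁ n) with hcdef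
  -- ### (3): all exits near `q` have the value `c n`
  have hfar : ∀ n, δs n < ra / 200 → ∀ x ∈ arcVertices R.carrier (δs n) (R.arc 0) ∪ arcVertices R.carrier (δs n) (R.arc 2),
      ε + 3 * δs n ≤ dist (meshPoint (δs n) x) q := by
    intro n hn x hx
    have hx' : ∃ t ∈ R.arc 0 ∪ R.arc 2, dist (meshPoint (δs n) x) t ≤ δs n := by
      rcases hx with hx | hx
      · obtain ⟨t, ht, hd⟩ := exists_mem_arc_dist_le (hδ n).le hx; exact ⟨t, Or.inl ht, hd⟩
      · obtain ⟨t, ht, hd⟩ := exists_mem_arc_dist_le (hδ n).le hx; exact ⟨t, Or.inr ht, hd⟩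
    obtain ⟨t, ht, hd⟩ := hx'
    have := hDq t ht
    have hraD : ra ≤ D / 4 := by
      have : ρ ≤ ε := hρε
      linarith [hraρ]
    linarith [dist_triangle q (meshPoint (δs n) x) t, dist_comm q (meshPoint (δs n) x)]
  have h3 : ∀ᶠ n in atTop, ∀ p p' : Site 2, (dualGraph R.carrier (δs n)).Reachable (p₀ n) p →
      (zdGraph 2).Adj p p' → ¬ (dualGraph R.carrier (δs n)).Reachable (p₀ n) p' →
      (∃ j ∈ closedSq (δs n) p', j ∈ frontier R.carrier ∧ dist j q < ra) →
      exitVal R.carrier (δs n) (h n) (p₀ n) p p' = c n := by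
    filter_upwards [hgood] with n hn p p' hpF hpp' hp'F hj
    obtain ⟨hp0, Hr', hnra, hnρ, hnsr, hEn'⟩ := hn
    obtain ⟨j, hjsq, hjfr, hjq⟩ := hj
    obtain ⟨j₁, hj₁sq, hj₁fr⟩ := hj₁ n ⟨hp0, Hr', hnra, hnρ, hnsr, hEn'⟩
    have hj₁q : dist j₁ q < ra := by
      have := hn₁near n ⟨hp0, Hr', hnra, hnρ, hnsr, hEn'⟩ j₁ hj₁sq; linarith
    -- the short arc between `j` and `j₁`
    obtain ⟨a, a', haa', hends, harc⟩ := hshort s₀ j j₁ hjfr hj₁fr (hjq.trans_le hra₀') (hj₁q.trans_le hra₀')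
    have harc' : ∀ t ∈ Icc a a', dist (R.boundary t) (R.boundary s₀) < ρ - 6 * δs n := fun t ht => by
      have := harc t ht; linarith
    have hfar' : ∀ x ∈ arcVertices R.carrier (δs n) (R.arc 0) ∪ arcVertices R.carrier (δs n) (R.arc 2),
        ε + 3 * δs n ≤ dist (meshPoint (δs n) x) (R.boundary s₀) := hfar n hnra
    rcases hends with ⟨ha, ha'⟩ | ⟨ha, ha'⟩
    · exact exitVal_eq_exitVal R h0 (hδ n) (hTsub n) (hBsub n) (hharm n) hp0 hεpos hρε (hULC s₀) hfar' hpF hpp'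
        (hp₁F n ⟨hp0, Hr', hnra, hnρ, hnsr, hEn'⟩) (hadj₁ n ⟨hp0, Hr', hnra, hnρ, hnsr, hEn'⟩) haa' (by rw [ha]; exact hjsq)
        (by rw [ha']; exact hj₁sq) harc'
    · exact (exitVal_eq_exitVal R h0 (hδ n) (hTsub n) (hBsub n) (hharm n) hp0 hεpos hρε (hULC s₀) hfar'
        (hp₁F n ⟨hp0, Hr', hnra, hnρ, hnsr, hEn'⟩) (hadj₁ n ⟨hp0, Hr', hnra, hnρ, hnsr, hEn'⟩) hpF hpp' haa' (by rw [ha]; exact hj₁sq)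
        (by rw [ha']; exact hjsq) harc').symm
  -- ### (4): the canonical exit is within `ra / 2` of `q`
  have h4 : ∀ᶠ n in atTop, ∃ p p' : Site 2, (dualGraph R.carrier (δs n)).Reachable (p₀ n) p ∧
      (zdGraph 2).Adj p p' ∧ ¬ (dualGraph R.carrier (δs n)).Reachable (p₀ n) p' ∧
      (∃ j ∈ closedSq (δs n) p', j ∈ frontier R.carrier ∧ dist j q < ra / 2) ∧
      exitVal R.carrier (δs n) (h n) (p₀ n) p p' = c n := by
    filter_upwards [hgood] with n hn
    obtain ⟨hp0, Hr', hnra, hnρ, hnsr, hEn'⟩ := hn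
    obtain ⟨j₁, hj₁sq, hj₁fr⟩ := hj₁ n ⟨hp0, Hr', hnra, hnρ, hnsr, hEn'⟩
    refine ⟨p₁ n, n₁ n, hp₁F n ⟨hp0, Hr', hnra, hnρ, hnsr, hEn'⟩, hadj₁ n ⟨hp0, Hr', hnra, hnρ, hnsr, hEn'⟩,
      hn₁F n ⟨hp0, Hr', hnra, hnρ, hnsr, hEn'⟩, ⟨j₁, hj₁sq, hj₁fr, ?_⟩, rfl⟩
    have := hn₁near n ⟨hp0, Hr', hnra, hnρ, hnsr, hEn'⟩ j₁ hj₁sq; linarith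
  -- ### the weak Beurling bound near `q`
  have hext : ∀ n, ∃ e : ℂ, e ∈ (closure R.carrier)ᶜ ∧ dist e q < δs n / 2 := fun n => by
    obtain ⟨e, he, hd⟩ := Metric.mem_closure_iff.1 (R.frontier_subset_closure_exterior' hqfr) (δs n / 2) (by have := hδ n; positivity)
    exact ⟨e, he, by rwa [_root_.dist_comm]⟩
  choose e he heq using hext
  have hα := beurlingExp_pos
  have hkey : ∀ θ : ℝ, 0 < θ → θ ≤ 1 → ∃ r > 0, ∀ᶠ n in atTop, ∀ z : Site 2,
      (dualGraph R.carrier (δs n)).Reachable (p₀ n) z → dist (meshPoint (δs n) z) q ≤ r →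
      |dualPot R.carrier (δs n) (h n) (p₀ n) z - c n| ≤ KE * θ ^ beurlingExp := by
    intro θ hθ hθ1
    refine ⟨θ * ra / 100, by positivity, ?_⟩
    filter_upwards [hgood, (tendsto_order.1 hδ0).2 _ (by positivity : (0 : ℝ) < θ * ra / 100)] with n hn hnθ z hzF hzq
    have hg := hn
    obtain ⟨hp0, Hr', hnra, hnρ, hnsr, hEn'⟩ := hn
    have hdpos : 0 < δs n := hδ n
    -- the box radius `Rb`
    have hx : 8 ≤ ⌊ra / (5 * δs n)⌋₊ := by
      have : (8 : ℝ) ≤ ra / (5 * δs n) := by rw [le_div_iff₀ (by positivity)]; linarith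
      exact Nat.le_floor this
    have hRbR : ((Rb n : ℕ) : ℝ) = (⌊ra / (5 * δs n)⌋₊ : ℝ) - 6 := by
      have : Rb n = ⌊ra / (5 * δs n)⌋₊ - 6 := rfl
      rw [this, Nat.cast_sub (by omega : 6 ≤ ⌊ra / (5 * δs n)⌋₊)]; push_cast; ring
    have hfl1 : (⌊ra / (5 * δs n)⌋₊ : ℝ) ≤ ra / (5 * δs n) := Nat.floor_le (by positivity)
    have hfl2 : ra / (5 * δs n) < (⌊ra / (5 * δs n)⌋₊ : ℝ) + 1 := Nat.lt_floor_add_one _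
    have hRb1 : 1 ≤ Rb n := by
      have : Rb n = ⌊ra / (5 * δs n)⌋₊ - 6 := rfl
      rw [this]; omega
    have hxd : ra / (5 * δs n) * δs n = ra / 5 := by field_simp
    have hflmul : (⌊ra / (5 * δs n)⌋₊ : ℝ) * δs n ≤ ra / 5 := by
      rw [← hxd]; exact mul_le_mul_of_nonneg_right hfl1 hdpos.le
    have hflmul' : ra / 5 < ((⌊ra / (5 * δs n)⌋₊ : ℝ) + 1) * δs n := by
      rw [← hxd]; exact mul_lt_mul_of_pos_right hfl2 hdpos
    have hRbup : (Rb n : ℝ) * δs n ≤ ra / 5 - 6 * δs n := by rw [hRbR, sub_mul]; linarith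
    have hRblo : ra / 5 - 7 * δs n < (Rb n : ℝ) * δs n := by rw [hRbR, sub_mul]; linarith
    have hbox : 2 * (2 * (Rb n : ℝ) + 10) * δs n < ra := by
      have e : 2 * (2 * (Rb n : ℝ) + 10) * δs n = 4 * ((Rb n : ℝ) * δs n) + 20 * δs n := by ring
      rw [e]; linarith
    -- short arcs and the far-ness of `T_n ∪ B_n`
    have harc : ∀ j j' : ℂ, j ∈ frontier R.carrier → j' ∈ frontier R.carrier →
        dist j (R.boundary s₀) < ra → dist j' (R.boundary s₀) < ra →
        ∃ a a' : ℝ, a ≤ a' ∧ ((R.boundary a = j ∧ R.boundary a' = j') ∨ (R.boundary a = j' ∧ R.boundary a' = j)) ∧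
          ∀ t ∈ Icc a a', dist (R.boundary t) (R.boundary s₀) < ρ - 6 * δs n := by
      intro j j' hj hj' hjq hj'q
      obtain ⟨a, a', haa', hends, harc⟩ := hshort s₀ j j' hj hj' (hjq.trans_le hra₀') (hj'q.trans_le hra₀')
      exact ⟨a, a', haa', hends, fun t ht => by have := harc t ht; linarith⟩
    -- the canonical exit is in the big box about `q`
    have hmpq : dist q (meshPoint (δs n) (floorSq (δs n) q)) ≤ 2 * δs n :=
      dist_le_of_mem_closedSq (mem_closedSq_floorSq hdpos q) (meshPoint_mem_closedSq hdpos.le (Or.inl rfl) (Or.inl rfl))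
    have hp₁b : p₁ n ∈ sqBox (floorSq (δs n) (R.boundary s₀)) (2 * ((Rb n : ℤ) + 3)) := by
      refine mem_sqBox_of_dist_le hdpos ?_
      have h1 := hp₁near n hg (meshPoint (δs n) (p₁ n)) (meshPoint_mem_closedSq hdpos.le (Or.inl rfl) (Or.inl rfl))
      have h2 := dist_triangle (meshPoint (δs n) (p₁ n)) q (meshPoint (δs n) (floorSq (δs n) q))
      push_cast
      have e : (2 * ((Rb n : ℝ) + 3)) * δs n = 2 * ((Rb n : ℝ) * δs n) + 6 * δs n := by ring
      rw [e]; linarith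
    -- the box about the exterior point `e n`
    set r : ℝ := θ * ra / 100 with hr
    set ρ' : ℕ := ⌈r / δs n⌉₊ + 3 with hρ'
    have hce1 : r / δs n ≤ (⌈r / δs n⌉₊ : ℝ) := Nat.le_ceil _
    have hce2 : (⌈r / δs n⌉₊ : ℝ) < r / δs n + 1 := Nat.ceil_lt_add_one (by positivity)
    have hrd : r / δs n * δs n = r := by field_simp
    have hρ'lo : r + 3 * δs n ≤ (ρ' : ℝ) * δs n := by
      rw [hρ']; push_cast
      have := mul_le_mul_of_nonneg_right hce1 hdpos.le
      rw [hrd] at this; linarith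
    have hρ'hi : (ρ' : ℝ) * δs n < r + 4 * δs n := by
      rw [hρ']; push_cast
      have := mul_lt_mul_of_pos_right hce2 hdpos
      rw [add_mul, hrd] at this; linarith
    have hmpe : dist (e n) (meshPoint (δs n) (floorSq (δs n) (e n))) ≤ 2 * δs n :=
      dist_le_of_mem_closedSq (mem_closedSq_floorSq hdpos (e n)) (meshPoint_mem_closedSq hdpos.le (Or.inl rfl) (Or.inl rfl))
    have hzρ : z ∈ sqBox (floorSq (δs n) (e n)) (ρ' : ℤ) := by
      refine mem_sqBox_of_dist_le hdpos ?_
      have h2 := dist_triangle4 (meshPoint (δs n) z) q (e n) (meshPoint (δs n) (floorSq (δs n) (e n)))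
      have h3 := heq n
      rw [_root_.dist_comm] at h3
      push_cast
      linarith
    have hzR : z ∈ sqBox (floorSq (δs n) (e n)) (Rb n : ℤ) := by
      refine mem_sqBox_of_dist_le hdpos ?_
      have h2 := dist_triangle4 (meshPoint (δs n) z) q (e n) (meshPoint (δs n) (floorSq (δs n) (e n)))
      have h3 := heq n
      rw [_root_.dist_comm] at h3
      push_cast
      have : r ≤ ra / 100 := by
        have := mul_le_mul_of_nonneg_right hθ1 hrapos.le
        rw [hr, one_mul] at *; linarith
      linarith
    -- the estimate
    have hmain := abs_dualPot_sub_exitVal_le R h0 hdpos (hTsub n) (hBsub n) (hharm n) (h01 n) hp0 hEn'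
      hεpos hρε (hULC s₀) harc (hfar n hnra) hRb1 (by exact_mod_cast hbox) (he n) (heq n)
      (hp₁F n hg) hp₁b (hadj₁ n hg) (hn₁F n hg) hzF hzρ hzR
    refine hmain.trans ?_
    rw [hKE]
    have hKE0 : 0 ≤ (1 + 8 * Real.sqrt E) * beurlingConst :=
      mul_nonneg (by positivity) beurlingConst_pos.le
    refine mul_le_mul_of_nonneg_left (Real.rpow_le_rpow (by positivity) ?_ hα.le) hKE0
    -- the ratio of the box radii is at most `θ`
    have hRb10 : ra / 10 ≤ ((Rb n : ℝ) + 1) * δs n := by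
      have e : ((Rb n : ℝ) + 1) * δs n = (Rb n : ℝ) * δs n + δs n := by ring
      rw [e]; linarith
    rw [div_le_iff₀ (by positivity)]
    have h1 : ((ρ' : ℝ) + 1) * δs n < r + 5 * δs n := by linarith
    have h2 : θ * (ra / 10) ≤ θ * (((Rb n : ℝ) + 1) * δs n) := mul_le_mul_of_nonneg_left hRb10 hθ.le
    have h3 : r + 5 * δs n ≤ θ * (ra / 10) := by rw [hr]; linarith
    have h4 : ((ρ' : ℝ) + 1) * δs n < (θ * ((Rb n : ℝ) + 1)) * δs n := by
      calc ((ρ' : ℝ) + 1) * δs n < r + 5 * δs n := h1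
        _ ≤ θ * (ra / 10) := h3
        _ ≤ θ * (((Rb n : ℝ) + 1) * δs n) := h2
        _ = (θ * ((Rb n : ℝ) + 1)) * δs n := by ring
    exact (lt_of_mul_lt_mul_right h4 hdpos.le).le
  -- ### for every `η > 0`: eventually `|h'_n(nearestSite w) - c n| ≤ η` for `w ∈ Ω` close to `q`
  have hkey' : ∀ η : ℝ, 0 < η → ∃ r > 0, ∀ w ∈ R.carrier, dist w q < r → ∀ᶠ n in atTop,
      |dualPot R.carrier (δs n) (h n) (p₀ n) (nearestSite (δs n) w) - c n| ≤ η := by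
    intro η hη
    set θ : ℝ := min 1 ((η / KE) ^ beurlingExp⁻¹) with hθ
    have hθpos : 0 < θ := by rw [hθ]; positivity
    have hθ1 : θ ≤ 1 := min_le_left _ _
    have hθη : KE * θ ^ beurlingExp ≤ η := by
      have h1 : θ ^ beurlingExp ≤ ((η / KE) ^ beurlingExp⁻¹) ^ beurlingExp :=
        Real.rpow_le_rpow hθpos.le (min_le_right _ _) hα.le
      rw [Real.rpow_inv_rpow (by positivity) hα.ne'] at h1
      calc KE * θ ^ beurlingExp ≤ KE * (η / KE) := mul_le_mul_of_nonneg_left h1 hKEpos.le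
        _ = η := by field_simp
    obtain ⟨r, hr, hb⟩ := hkey θ hθpos hθ1
    refine ⟨r / 2, by positivity, fun w hw hwq => ?_⟩
    obtain ⟨sw, hsw, δw, hδw, Hw⟩ := exists_forall_reachable_near R h0 hc hw
    filter_upwards [hb, (tendsto_order.1 hδ0).2 _ (lt_min hδw (lt_min hsw (half_pos hr)))] with n hn hd
    have hd1 : δs n < δw := hd.trans_le (min_le_left _ _)
    have hd2 : δs n < sw := hd.trans_le ((min_le_right _ _).trans (min_le_left _ _))
    have hd3 : δs n < r / 2 := hd.trans_le ((min_le_right _ _).trans (min_le_right _ _))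
    have hnear := dist_meshPoint_nearestSite_le (hδ n) w
    have hreach := ((Hw _ (hδ n) hd1).2 (nearestSite (δs n) w) (by rw [Metric.mem_ball]; linarith)).2
    refine (hn _ hreach ?_).trans hθη
    linarith [dist_triangle (meshPoint (δs n) (nearestSite (δs n) w)) w q]
  -- pointwise convergence of the conjugates
  have hpt : ∀ w ∈ R.carrier, Tendsto (fun n => dualPot R.carrier (δs n) (h n) (p₀ n) (nearestSite (δs n) w)) atTop (𝓝 (u w)) := by
    intro w hw
    obtain ⟨s', hs', hconv'⟩ := hconv w hw
    exact hconv'.tendsto_at (mem_ball_self hs')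
  -- ### (1): `c` is Cauchy
  have hcauchy : CauchySeq c := by
    rw [Metric.cauchySeq_iff]
    intro η hη
    obtain ⟨r, hr, hb⟩ := hkey' (η / 3) (by positivity)
    obtain ⟨w₀, hw₀Ω, hw₀q⟩ : ∃ w₀ ∈ R.carrier, dist w₀ q < r := by
      obtain ⟨w₀, hw₀, hd⟩ := Metric.mem_closure_iff.1 (frontier_subset_closure hqfr) r hr
      exact ⟨w₀, hw₀, by rwa [_root_.dist_comm]⟩
    have hc₀ := (hpt w₀ hw₀Ω).cauchySeq
    rw [Metric.cauchySeq_iff] at hc₀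
    obtain ⟨N₁, hN₁⟩ := hc₀ (η / 3) (by positivity)
    obtain ⟨N₂, hN₂⟩ := eventually_atTop.1 (hb w₀ hw₀Ω hw₀q)
    refine ⟨max N₁ N₂, fun m hm n hn => ?_⟩
    have hm₁ : N₁ ≤ m := (le_max_left _ _).trans hm
    have hn₁ : N₁ ≤ n := (le_max_left _ _).trans hn
    have hm₂ := hN₂ m ((le_max_right _ _).trans hm)
    have hn₂ := hN₂ n ((le_max_right _ _).trans hn)
    have h12 := hN₁ m hm₁ n hn₁
    rw [Real.dist_eq] at h12 ⊢
    rw [abs_sub_comm] at hm₂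
    have e : c m - c n = (c m - dualPot R.carrier (δs m) (h m) (p₀ m) (nearestSite (δs m) w₀)) +
        (dualPot R.carrier (δs m) (h m) (p₀ m) (nearestSite (δs m) w₀) - dualPot R.carrier (δs n) (h n) (p₀ n) (nearestSite (δs n) w₀)) +
        (dualPot R.carrier (δs n) (h n) (p₀ n) (nearestSite (δs n) w₀) - c n) := by ring
    rw [e]
    refine (abs_add_three _ _ _).trans_lt ?_
    linarith
  obtain ⟨U, hU⟩ := cauchySeq_tendsto_of_complete hcauchy
  -- ### (2): boundary values of `u`
  have h2 : ∀ η > 0, ∃ r > 0, ∀ w ∈ R.carrier, dist w q < r → |u w - U| ≤ η := by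
    intro η hη
    obtain ⟨r, hr, hb⟩ := hkey' η hη
    refine ⟨r, hr, fun w hw hwq => ?_⟩
    have hlim : Tendsto (fun n => dualPot R.carrier (δs n) (h n) (p₀ n) (nearestSite (δs n) w) - c n) atTop (𝓝 (u w - U)) :=
      (hpt w hw).sub hU
    exact le_of_tendsto ((continuous_abs.tendsto _).comp hlim) (hb w hw hwq)
  exact ⟨U, c, hU, h2, h3, h4⟩

end BoundaryValues

/-! ### §B3. The current out of `T_n` is the effective conductance -/

section EnergyIdentity

open Finset

variable {δ : ℝ}

/-- Symmetrisation over a finite vertex set containing all edges: a sum over ordered adjacent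
pairs is the sum over the edges of the symmetrised summand. [folklore] -/
theorem sum_sum_adj_eq_sum_edgeFinset' {V : Type*} [DecidableEq V] (G : SimpleGraph V) [DecidableRel G.Adj]
    [Fintype G.edgeSet] (S : Finset V) (hS : ∀ x y, G.Adj x y → x ∈ S) (g : V → V → ℝ) :
    ∑ z ∈ S, ∑ w ∈ S, (if G.Adj z w then g z w else 0) =
      ∑ e ∈ G.edgeFinset, Sym2.lift ⟨fun a b => g a b + g b a, fun _ _ => add_comm _ _⟩ e := by
  set A := (S ×ˢ S).filter (fun p => G.Adj p.1 p.2) with hA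
  have hL : ∑ p ∈ A, g p.1 p.2 = ∑ z ∈ S, ∑ w ∈ S, (if G.Adj z w then g z w else 0) := by
    rw [hA, sum_filter, sum_product]
  have hmaps : ∀ p ∈ A, s(p.1, p.2) ∈ G.edgeFinset := fun p hp => by
    rw [SimpleGraph.mem_edgeFinset]
    exact (mem_filter.1 hp).2
  rw [← hL, ← sum_fiberwise_of_maps_to hmaps]
  refine sum_congr rfl fun e he => ?_
  induction e with
  | h a b =>
    have hab : G.Adj a b := by simpa using he
    have hfib : A.filter (fun p => s(p.1, p.2) = s(a, b)) = {(a, b), (b, a)} := by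
      ext ⟨p, q⟩
      simp only [hA, mem_filter, mem_product, Finset.mem_insert, Finset.mem_singleton, Prod.mk.injEq]
      constructor
      · rintro ⟨-, h⟩
        exact Sym2.eq_iff.1 h
      · rintro (⟨rfl, rfl⟩ | ⟨rfl, rfl⟩)
        · exact ⟨⟨⟨hS _ _ hab, hS _ _ hab.symm⟩, hab⟩, rfl⟩
        · exact ⟨⟨⟨hS _ _ hab.symm, hS _ _ hab⟩, hab.symm⟩, Sym2.eq_swap⟩
    have hne : (a, b) ≠ (b, a) := fun h => hab.ne (Prod.mk.inj h).1
    rw [hfib, sum_pair hne]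
    rfl

/-- **Summation by parts on a finite vertex set**: `Σ_{e = ab} (f a - f b)² = Σ_z f z · Σ_{w ~ z} (f z - f w)`.
[folklore] -/
theorem sum_sqIncr_eq_sum_mul_laplacian {V : Type*} [DecidableEq V] (G : SimpleGraph V) [DecidableRel G.Adj]
    [Fintype G.edgeSet] (S : Finset V) (hS : ∀ x y, G.Adj x y → x ∈ S) (f : V → ℝ) :
    ∑ e ∈ G.edgeFinset, sqIncr f e = ∑ z ∈ S, f z * ∑ w ∈ S, (if G.Adj z w then (f z - f w) else 0) := by
  have h : ∀ z, f z * ∑ w ∈ S, (if G.Adj z w then (f z - f w) else 0) =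
      ∑ w ∈ S, (if G.Adj z w then f z * (f z - f w) else 0) := fun z => by
    rw [mul_sum]
    exact sum_congr rfl fun w _ => by rw [mul_ite, mul_zero]
  simp_rw [h]
  rw [sum_sum_adj_eq_sum_edgeFinset' G S hS]
  refine sum_congr rfl fun e _ => ?_
  induction e with
  | h a b =>
    simp only [Sym2.lift_mk, sqIncr_mk]
    ring

open Classical in
/-- **The current out of `T_n` equals the conductance.** For the potential `h` of `Ω_n`
(`= 1` on `T_n`, `= 0` on `B_n`, harmonic elsewhere, with `energy = 𝒞(T_n ↔ B_n)`):
`Σ_{x ∈ T_n} div(x) = 𝒞(T_n ↔ B_n)` where `div(x) = Σ_{y ~ x} (h x - h y)` is the current out of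
`x` (`divAt_cur`). [folklore] -/
theorem sum_divAt_eq_toReal_conductance (R : RandomPlanarGeometry.ConformalRectangle) (hδ : 0 < δ) {h : Site 2 → ℝ}
    (hT : (arcVertices R.carrier δ (R.arc 0)).EqOn h 1) (hB : (arcVertices R.carrier δ (R.arc 2)).EqOn h 0)
    (hE : networkEnergy (domainGraph R.carrier δ) 1 h =
      effectiveConductance (domainGraph R.carrier δ) 1 (arcVertices R.carrier δ (R.arc 0)) (arcVertices R.carrier δ (R.arc 2)))
    (hharm : ∀ x, x ∉ arcVertices R.carrier δ (R.arc 0) → x ∉ arcVertices R.carrier δ (R.arc 2) →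
      ∑ y ∈ ((zdGraph 2).neighborFinset x).filter (fun y => (domainGraph R.carrier δ).Adj x y), (h y - h x) = 0)
    (hfin : (arcVertices R.carrier δ (R.arc 0)).Finite) :
    ∑ x ∈ hfin.toFinset, divAt (curH R.carrier δ h) (curV R.carrier δ h) (x - 1) =
      (effectiveConductance (domainGraph R.carrier δ) 1 (arcVertices R.carrier δ (R.arc 0)) (arcVertices R.carrier δ (R.arc 2))).toReal := by
  haveI : Fintype (domainGraph R.carrier δ).edgeSet := (edgeSet_domainGraph_finite R.isBounded hδ).fintype
  set G := domainGraph R.carrier δ with hG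
  set S : Finset (Site 2) := (domain_finite R.isBounded hδ).toFinset with hS
  have hSmem : ∀ x y, G.Adj x y → x ∈ S := fun x y hxy => by
    rw [hS, Set.Finite.mem_toFinset]; exact (domainGraph_adj_iff.1 hxy).2.1
  -- the energy as a real sum
  have hEreal : (networkEnergy G 1 h).toReal = ∑ e ∈ G.edgeFinset, sqIncr h e := by
    rw [networkEnergy_eq_sum]
    rw [ENNReal.toReal_sum (fun e _ => ENNReal.mul_ne_top ENNReal.coe_ne_top ENNReal.ofReal_ne_top)]
    refine sum_congr rfl fun e _ => ?_
    simp [ENNReal.toReal_ofReal (sqIncr_nonneg h e)]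
  rw [← hE, hEreal, sum_sqIncr_eq_sum_mul_laplacian G S hSmem h]
  -- the inner sums are the lattice Laplacians
  have hinner : ∀ z : Site 2, ∑ w ∈ S, (if G.Adj z w then (h z - h w) else 0) =
      -∑ y ∈ ((zdGraph 2).neighborFinset z).filter (fun y => G.Adj z y), (h y - h z) := by
    intro z
    rw [sum_filter, ← sum_neg_distrib]
    -- both sides are sums over the `G`-neighbours of `z`
    have h1 : ∑ w ∈ S, (if G.Adj z w then (h z - h w) else 0) = ∑ w ∈ S.filter (fun w => G.Adj z w), (h z - h w) := by
      rw [sum_filter]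
    have h2 : ∑ y ∈ (zdGraph 2).neighborFinset z, -(if G.Adj z y then (h y - h z) else 0) =
        ∑ y ∈ ((zdGraph 2).neighborFinset z).filter (fun y => G.Adj z y), (h z - h y) := by
      rw [sum_filter]
      refine sum_congr rfl fun y _ => ?_
      split_ifs <;> ring
    rw [h1, h2]
    refine sum_congr ?_ fun _ _ => rfl
    ext w
    simp only [mem_filter, SimpleGraph.mem_neighborFinset]
    constructor
    · rintro ⟨-, hw⟩; exact ⟨domainGraph_le_zdGraph _ _ hw, hw⟩
    · rintro ⟨-, hw⟩; exact ⟨hSmem _ _ hw.symm, hw⟩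
  simp_rw [hinner]
  -- split the vertex sum: only `T_n` contributes
  have hTS : hfin.toFinset ⊆ S := fun x hx => by
    rw [Set.Finite.mem_toFinset] at hx
    rw [hS, Set.Finite.mem_toFinset]; exact hx.1.1
  rw [← sum_subset hTS]
  · refine sum_congr rfl fun x hx => ?_
    rw [Set.Finite.mem_toFinset] at hx
    have hx1 : h x = 1 := hT hx
    rw [divAt_cur, hx1, one_mul]
  · intro x hxS hxT
    rw [Set.Finite.mem_toFinset] at hxT
    by_cases hxB : x ∈ arcVertices R.carrier δ (R.arc 2)
    · rw [hB hxB]; simp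
    · rw [hharm x hxT hxB]; simp

end EnergyIdentity

/-! ### §B4. Uniqueness of boundary limits; locally constant functions on intervals -/

section LocConst

/-- Boundary limits within a set at a point of its closure are unique. [folklore] -/
theorem boundaryLimit_unique {Ω : Set ℂ} {q : ℂ} (hq : q ∈ closure Ω) {u : ℂ → ℝ} {U U' : ℝ}
    (hU : ∀ η > 0, ∃ r > 0, ∀ w ∈ Ω, dist w q < r → |u w - U| ≤ η)
    (hU' : ∀ η > 0, ∃ r > 0, ∀ w ∈ Ω, dist w q < r → |u w - U'| ≤ η) : U = U' := by
  by_contra hne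
  have hpos : 0 < |U - U'| := abs_pos.2 (sub_ne_zero.2 hne)
  obtain ⟨r, hr, h1⟩ := hU (|U - U'| / 3) (by positivity)
  obtain ⟨r', hr', h2⟩ := hU' (|U - U'| / 3) (by positivity)
  obtain ⟨w, hw, hd⟩ := Metric.mem_closure_iff.1 hq (min r r') (by positivity)
  have e1 := h1 w hw (by rw [_root_.dist_comm]; exact hd.trans_le (min_le_left _ _))
  have e2 := h2 w hw (by rw [_root_.dist_comm]; exact hd.trans_le (min_le_right _ _))
  have := abs_sub_le U (u w) U'
  rw [abs_sub_comm U (u w)] at this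
  linarith

/-- A function on an open interval which is locally constant is constant. [folklore] -/
theorem eq_of_locallyConstant_Ioo {m M : ℝ} {g : ℝ → ℝ}
    (hg : ∀ s₀ ∈ Ioo m M, ∃ ε > 0, ∀ s ∈ Ioo m M, |s - s₀| < ε → g s = g s₀)
    {s s' : ℝ} (hs : s ∈ Ioo m M) (hs' : s' ∈ Ioo m M) : g s = g s' := by
  haveI : PreconnectedSpace (Ioo m M) := isPreconnected_iff_preconnectedSpace.1 isPreconnected_Ioo
  set G : Ioo m M → ℝ := fun x => g x with hG
  have hlc : IsLocallyConstant G := by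
    rw [IsLocallyConstant.iff_eventually_eq]
    intro x
    obtain ⟨ε, hε, hεg⟩ := hg x x.2
    rw [Metric.eventually_nhds_iff]
    exact ⟨ε, hε, fun y hy => hεg y y.2 (by rw [← Real.dist_eq]; exact hy)⟩
  exact hlc.apply_eq_of_preconnectedSpace ⟨s, hs⟩ ⟨s', hs'⟩

end LocConst

/-! ### §B5. Conformal invariance of the Dirichlet energy of a holomorphic function -/

section ChangeOfVariables

open MeasureTheory Literature.Analysis.Complex

/-- **Change of variables for the energy.** For a conformal bijection `Ψ` of an open set `U` onto
`Ψ(U)` (open) and `f` holomorphic on `Ψ(U)`: `∫∫_U ‖(f ∘ Ψ)'‖² = ∫∫_{Ψ(U)} ‖f'‖²`. [folklore] -/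
theorem lintegral_deriv_comp_sq_eq {Ψ f : ℂ → ℂ} {U : Set ℂ} (hU : IsOpen U) (hΨd : DifferentiableOn ℂ Ψ U)
    (hΨinj : InjOn Ψ U) (hV : IsOpen (Ψ '' U)) (hfd : DifferentiableOn ℂ f (Ψ '' U)) :
    ∫⁻ z in U, ‖deriv (f ∘ Ψ) z‖ₑ ^ 2 = ∫⁻ w in Ψ '' U, ‖deriv f w‖ₑ ^ 2 := by
  rw [lintegral_image_eq_lintegral_abs_det_fderiv_mul volume hU.measurableSet
    (fun z hz => AreaMultiplicity.hasFDerivWithinAt_restrictScalars hU hΨd Subset.rfl hz) hΨinj]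
  refine setLIntegral_congr_fun hU.measurableSet fun z hz => ?_
  rw [LengthArea.det_restrictScalars_smulRight, abs_of_nonneg (by positivity)]
  -- chain rule
  have hΨz : HasDerivAt Ψ (deriv Ψ z) z := (hΨd.differentiableAt (hU.mem_nhds hz)).hasDerivAt
  have hfz : HasDerivAt f (deriv f (Ψ z)) (Ψ z) := (hfd.differentiableAt (hV.mem_nhds (mem_image_of_mem Ψ hz))).hasDerivAt
  rw [(hfz.comp z hΨz).deriv, enorm_mul, mul_pow, mul_comm]
  congr 1
  rw [← ofReal_norm, ← ENNReal.ofReal_pow (norm_nonneg _)]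

end ChangeOfVariables

/-! ### §B6. The rectangle energy inequality -/

section RectangleEnergy

open _root_.MeasureTheory

open Literature.Analysis.Complex Complex

/-- **Cauchy–Schwarz on an interval**: `(∫_s g)² ≤ (∫_s g²) · |s|`. [folklore] -/
theorem lintegral_sq_le_lintegral_sq_mul {g : ℝ → ℝ≥0∞} (hg : Measurable g) (s : Set ℝ) :
    (∫⁻ x in s, g x) ^ 2 ≤ (∫⁻ x in s, g x ^ 2) * volume s := by
  set μ : Measure ℝ := volume.restrict s with hμ
  have h := ENNReal.lintegral_mul_le_Lp_mul_Lq μ Real.HolderConjugate.two_two hg.aemeasurable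
    (g := fun _ ↦ 1) aemeasurable_const
  simp only [Pi.mul_apply, mul_one, lintegral_const, ENNReal.rpow_two, one_pow, one_mul] at h
  rw [hμ, Measure.restrict_apply_univ] at h
  calc (∫⁻ x in s, g x) ^ 2
      ≤ ((∫⁻ x in s, g x ^ 2) ^ (1 / 2 : ℝ) * volume s ^ (1 / 2 : ℝ)) ^ 2 := pow_le_pow_left' h 2
    _ = (∫⁻ x in s, g x ^ 2) * volume s := by
        rw [← ENNReal.mul_rpow_of_nonneg _ _ (by norm_num : (0 : ℝ) ≤ 1 / 2), ← ENNReal.rpow_two,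
          ← ENNReal.rpow_mul]
        norm_num

/-- **The increment of `Re F` along a horizontal line of the rectangle is controlled by the
energy on that line**: if `F` is holomorphic on `(0,a)×(0,1)` and `Re F(x+iy) → u₀` as `x → 0+`,
`→ u₁` as `x → a-`, then `(u₁ - u₀)² ≤ a ∫₀ᵃ ‖F'(x+iy)‖² dx` (fundamental theorem of calculus and
Cauchy–Schwarz). [folklore] -/
theorem ofReal_sq_sub_le_mul_lintegral_line {a : ℝ} (ha : 0 < a) {F : ℂ → ℂ}
    (hF : DifferentiableOn ℂ F (Ioo 0 a ×ℂ Ioo 0 1)) {y : ℝ} (hy : y ∈ Ioo (0 : ℝ) 1) {u₀ u₁ : ℝ}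
    (h0 : Tendsto (fun x : ℝ => (F (x + y * I)).re) (𝓝[>] 0) (𝓝 u₀))
    (h1 : Tendsto (fun x : ℝ => (F (x + y * I)).re) (𝓝[<] a) (𝓝 u₁)) :
    ENNReal.ofReal ((u₁ - u₀) ^ 2) ≤
      ENNReal.ofReal a * ∫⁻ x in Ioo 0 a, ‖deriv F ((x : ℂ) + (y : ℂ) * I)‖ₑ ^ 2 := by
  have hopen : IsOpen (Ioo 0 a ×ℂ Ioo (0 : ℝ) 1) := isOpen_Ioo.reProdIm isOpen_Ioo
  set c : ℝ → ℂ := fun x => F ((x : ℂ) + (y : ℂ) * I) with hc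
  set c' : ℝ → ℂ := fun x => deriv F ((x : ℂ) + (y : ℂ) * I) with hc'
  have hmem : ∀ x ∈ Ioo (0 : ℝ) a, (x : ℂ) + (y : ℂ) * I ∈ Ioo 0 a ×ℂ Ioo (0 : ℝ) 1 := fun x hx => by
    rw [mem_reProdIm]; constructor <;> simp [hx.1, hx.2, hy.1, hy.2]
  have hderiv : ∀ x ∈ Ioo (0 : ℝ) a, HasDerivAt c (c' x) x := by
    intro x hx
    have hFd : HasDerivAt F (deriv F ((x : ℂ) + (y : ℂ) * I)) ((x : ℂ) + (y : ℂ) * I) :=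
      (hF.differentiableAt (hopen.mem_nhds (hmem x hx))).hasDerivAt
    have h2 : HasDerivAt (fun w : ℂ => F (w + (y : ℂ) * I)) (deriv F ((x : ℂ) + (y : ℂ) * I)) (x : ℂ) :=
      HasDerivAt.comp_add_const (x : ℂ) ((y : ℂ) * I) hFd
    exact h2.comp_ofReal
  have hcont' : ContinuousOn c' (Ioo 0 a) := by
    have hdc : ContinuousOn (deriv F) (Ioo 0 a ×ℂ Ioo (0 : ℝ) 1) :=
      (hF.analyticOnNhd hopen).deriv.continuousOn
    exact hdc.comp (by fun_prop) fun x hx => hmem x hx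
  -- the bound for `0 < ε < a/2`
  have hbound : ∀ ε, 0 < ε → ε < a / 2 →
      ENNReal.ofReal (((c (a - ε)).re - (c ε).re) ^ 2) ≤
        ENNReal.ofReal a * ∫⁻ x in Ioo 0 a, ‖c' x‖ₑ ^ 2 := by
    intro ε hε0 hεa
    have h1 : ‖c (a - ε) - c ε‖ₑ ≤ ∫⁻ x in Ioc ε (a - ε), ‖c' x‖ₑ :=
      LengthArea.enorm_sub_le_lintegral hderiv hcont' hε0 (by linarith) (by linarith)
    have h2 : ∫⁻ x in Ioc ε (a - ε), ‖c' x‖ₑ ≤ ∫⁻ x in Ioo 0 a, ‖c' x‖ₑ :=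
      lintegral_mono_set fun x hx => ⟨hε0.trans hx.1, by linarith [hx.2]⟩
    have h3 := lintegral_sq_le_lintegral_sq_mul (g := fun x => ‖c' x‖ₑ)
      ((measurable_deriv F).comp (by fun_prop)).enorm (Ioo 0 a)
    rw [Real.volume_Ioo, sub_zero] at h3
    have h4 : |(c (a - ε)).re - (c ε).re| ≤ ‖c (a - ε) - c ε‖ := by
      rw [← Complex.sub_re]; exact Complex.abs_re_le_norm _
    calc ENNReal.ofReal (((c (a - ε)).re - (c ε).re) ^ 2)
        = ENNReal.ofReal (|(c (a - ε)).re - (c ε).re|) ^ 2 := by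
          rw [← ENNReal.ofReal_pow (abs_nonneg _), sq_abs]
      _ ≤ ‖c (a - ε) - c ε‖ₑ ^ 2 := by
          gcongr
          rw [← ofReal_norm]
          exact ENNReal.ofReal_le_ofReal h4
      _ ≤ (∫⁻ x in Ioo 0 a, ‖c' x‖ₑ) ^ 2 := by gcongr; exact h1.trans h2
      _ ≤ (∫⁻ x in Ioo 0 a, ‖c' x‖ₑ ^ 2) * ENNReal.ofReal a := h3
      _ = ENNReal.ofReal a * ∫⁻ x in Ioo 0 a, ‖c' x‖ₑ ^ 2 := mul_comm _ _
  -- pass to the limit `ε → 0+`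
  have hlim : Tendsto (fun ε : ℝ => ENNReal.ofReal (((c (a - ε)).re - (c ε).re) ^ 2)) (𝓝[>] 0)
      (𝓝 (ENNReal.ofReal ((u₁ - u₀) ^ 2))) := by
    have ha' : Tendsto (fun ε : ℝ => a - ε) (𝓝[>] 0) (𝓝[<] a) := by
      refine tendsto_nhdsWithin_of_tendsto_nhds_of_eventually_within _ ?_ ?_
      · have : Tendsto (fun ε : ℝ => a - ε) (𝓝 0) (𝓝 (a - 0)) := tendsto_const_nhds.sub tendsto_id
        rw [sub_zero] at this
        exact this.mono_left nhdsWithin_le_nhds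
      · filter_upwards [self_mem_nhdsWithin] with ε hε
        simp only [mem_Iio]; linarith [mem_Ioi.1 hε]
    have hA : Tendsto (fun ε : ℝ => (c (a - ε)).re) (𝓝[>] 0) (𝓝 u₁) := h1.comp ha'
    have hB : Tendsto (fun ε : ℝ => (c ε).re) (𝓝[>] 0) (𝓝 u₀) := h0
    exact (ENNReal.continuous_ofReal.tendsto _).comp ((hA.sub hB).pow 2)
  refine le_of_tendsto hlim ?_
  have hmem' : ∀ᶠ ε in 𝓝[>] (0 : ℝ), ε < a / 2 := by
    have : Iio (a / 2) ∈ 𝓝 (0 : ℝ) := Iio_mem_nhds (by linarith)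
    exact mem_nhdsWithin_of_mem_nhds this
  filter_upwards [self_mem_nhdsWithin, hmem'] with ε hε hε'
  exact hbound ε hε hε'

/-- **The rectangle energy inequality.** If `F` is holomorphic on the rectangle `(0,a)×(0,1)`
and on every horizontal line `Re F → u₀` at the left side and `→ u₁` at the right side, then
`(u₁ - u₀)² / a ≤ ∬ ‖F'‖²`. This is the length–area computation of Ahlfors (1973), §4-2 for the
rectangle, applied to the level lines of the rectangle itself. [cite: Ahlfors1973CI, §4-2 p. 53] -/
theorem ofReal_sq_sub_div_le_lintegral_rect {a : ℝ} (ha : 0 < a) {F : ℂ → ℂ}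
    (hF : DifferentiableOn ℂ F (Ioo 0 a ×ℂ Ioo 0 1)) {u₀ u₁ : ℝ}
    (h0 : ∀ y ∈ Ioo (0 : ℝ) 1, Tendsto (fun x : ℝ => (F (x + y * I)).re) (𝓝[>] 0) (𝓝 u₀))
    (h1 : ∀ y ∈ Ioo (0 : ℝ) 1, Tendsto (fun x : ℝ => (F (x + y * I)).re) (𝓝[<] a) (𝓝 u₁)) :
    ENNReal.ofReal ((u₁ - u₀) ^ 2 / a) ≤ ∫⁻ z in Ioo 0 a ×ℂ Ioo 0 1, ‖deriv F z‖ₑ ^ 2 := by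
  have hmeas : Measurable fun z => ‖deriv F z‖ₑ ^ 2 := (measurable_deriv F).enorm.pow_const 2
  rw [ExtremalLength.lintegral_rectangle_eq hmeas]
  have hline : ∀ y ∈ Ioo (0 : ℝ) 1, ENNReal.ofReal ((u₁ - u₀) ^ 2 / a) ≤
      ∫⁻ x in Ioo 0 a, ‖deriv F ((x : ℂ) + (y : ℂ) * I)‖ₑ ^ 2 := by
    intro y hy
    have h := ofReal_sq_sub_le_mul_lintegral_line ha hF hy (h0 y hy) (h1 y hy)
    have ha' : ENNReal.ofReal a ≠ 0 := (ENNReal.ofReal_pos.2 ha).ne'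
    rw [ENNReal.ofReal_div_of_pos ha]
    refine (ENNReal.div_le_iff ha' ENNReal.ofReal_ne_top).2 ?_
    rwa [mul_comm] at h
  calc ENNReal.ofReal ((u₁ - u₀) ^ 2 / a) = ∫⁻ _ in Ioo (0 : ℝ) 1, ENNReal.ofReal ((u₁ - u₀) ^ 2 / a) := by
        rw [setLIntegral_const, Real.volume_Ioo, sub_zero, ENNReal.ofReal_one, mul_one]
    _ ≤ ∫⁻ y in Ioo (0 : ℝ) 1, ∫⁻ x in Ioo 0 a, ‖deriv F ((x : ℂ) + (y : ℂ) * I)‖ₑ ^ 2 :=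
        setLIntegral_mono' measurableSet_Ioo fun y hy => hline y hy

end RectangleEnergy

section RectangleEnergyH

open _root_.MeasureTheory

open Literature.Analysis.Complex Complex

/-- **The increment of `Re F` along a vertical line of the rectangle is controlled by the energy on
that line**: if `F` is holomorphic on `(0,a)×(0,b)` and `Re F(x+iy) → u₀` as `y → 0+`, `→ u₁` as
`y → b-`, then `(u₁ - u₀)² ≤ b ∫₀ᵇ ‖F'(x+iy)‖² dy`. [folklore] -/
theorem ofReal_sq_sub_le_mul_lintegral_vline {a b : ℝ} (hb : 0 < b) {F : ℂ → ℂ}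
    (hF : DifferentiableOn ℂ F (Ioo 0 a ×ℂ Ioo 0 b)) {x : ℝ} (hx : x ∈ Ioo (0 : ℝ) a) {u₀ u₁ : ℝ}
    (h0 : Tendsto (fun y : ℝ => (F (x + y * I)).re) (𝓝[>] 0) (𝓝 u₀))
    (h1 : Tendsto (fun y : ℝ => (F (x + y * I)).re) (𝓝[<] b) (𝓝 u₁)) :
    ENNReal.ofReal ((u₁ - u₀) ^ 2) ≤
      ENNReal.ofReal b * ∫⁻ y in Ioo 0 b, ‖deriv F ((x : ℂ) + (y : ℂ) * I)‖ₑ ^ 2 := by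
  have hopen : IsOpen (Ioo 0 a ×ℂ Ioo (0 : ℝ) b) := isOpen_Ioo.reProdIm isOpen_Ioo
  set c : ℝ → ℂ := fun y => F ((x : ℂ) + (y : ℂ) * I) with hc
  set c' : ℝ → ℂ := fun y => deriv F ((x : ℂ) + (y : ℂ) * I) * I with hc'
  have hmem : ∀ y ∈ Ioo (0 : ℝ) b, (x : ℂ) + (y : ℂ) * I ∈ Ioo 0 a ×ℂ Ioo (0 : ℝ) b := fun y hy => by
    rw [mem_reProdIm]; constructor <;> simp [hx.1, hx.2, hy.1, hy.2]
  have hderiv : ∀ y ∈ Ioo (0 : ℝ) b, HasDerivAt c (c' y) y := by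
    intro y hy
    have hFd : HasDerivAt F (deriv F ((x : ℂ) + (y : ℂ) * I)) ((x : ℂ) + (y : ℂ) * I) :=
      (hF.differentiableAt (hopen.mem_nhds (hmem y hy))).hasDerivAt
    have hlin : HasDerivAt (fun w : ℂ => (x : ℂ) + w * I) I (y : ℂ) := by
      simpa using ((hasDerivAt_id (y : ℂ)).mul_const I).const_add (x : ℂ)
    have h2 : HasDerivAt (fun w : ℂ => F ((x : ℂ) + w * I)) (deriv F ((x : ℂ) + (y : ℂ) * I) * I) (y : ℂ) :=
      hFd.comp (y : ℂ) hlin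
    exact h2.comp_ofReal
  have hcont' : ContinuousOn c' (Ioo 0 b) := by
    have hdc : ContinuousOn (deriv F) (Ioo 0 a ×ℂ Ioo (0 : ℝ) b) :=
      (hF.analyticOnNhd hopen).deriv.continuousOn
    exact (hdc.comp (by fun_prop) fun y hy => hmem y hy).mul continuousOn_const
  have hI : ‖(I : ℂ)‖ₑ = 1 := by rw [← ofReal_norm]; simp
  have hnorm : ∀ y, ‖c' y‖ₑ = ‖deriv F ((x : ℂ) + (y : ℂ) * I)‖ₑ := fun y => by
    simp [hc', enorm_mul, hI]
  have hbound : ∀ ε, 0 < ε → ε < b / 2 →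
      ENNReal.ofReal (((c (b - ε)).re - (c ε).re) ^ 2) ≤
        ENNReal.ofReal b * ∫⁻ y in Ioo 0 b, ‖deriv F ((x : ℂ) + (y : ℂ) * I)‖ₑ ^ 2 := by
    intro ε hε0 hεb
    have h1 : ‖c (b - ε) - c ε‖ₑ ≤ ∫⁻ y in Ioc ε (b - ε), ‖c' y‖ₑ :=
      LengthArea.enorm_sub_le_lintegral hderiv hcont' hε0 (by linarith) (by linarith)
    have h2 : ∫⁻ y in Ioc ε (b - ε), ‖c' y‖ₑ ≤ ∫⁻ y in Ioo 0 b, ‖deriv F ((x : ℂ) + (y : ℂ) * I)‖ₑ := by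
      calc ∫⁻ y in Ioc ε (b - ε), ‖c' y‖ₑ ≤ ∫⁻ y in Ioo 0 b, ‖c' y‖ₑ :=
            lintegral_mono_set fun y hy => ⟨hε0.trans hy.1, by linarith [hy.2]⟩
        _ = _ := lintegral_congr fun y => hnorm y
    have h3 := lintegral_sq_le_lintegral_sq_mul (g := fun y => ‖deriv F ((x : ℂ) + (y : ℂ) * I)‖ₑ)
      ((measurable_deriv F).comp (by fun_prop)).enorm (Ioo 0 b)
    rw [Real.volume_Ioo, sub_zero] at h3
    have h4 : |(c (b - ε)).re - (c ε).re| ≤ ‖c (b - ε) - c ε‖ := by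
      rw [← Complex.sub_re]; exact Complex.abs_re_le_norm _
    calc ENNReal.ofReal (((c (b - ε)).re - (c ε).re) ^ 2)
        = ENNReal.ofReal (|(c (b - ε)).re - (c ε).re|) ^ 2 := by
          rw [← ENNReal.ofReal_pow (abs_nonneg _), sq_abs]
      _ ≤ ‖c (b - ε) - c ε‖ₑ ^ 2 := by
          gcongr
          rw [← ofReal_norm]
          exact ENNReal.ofReal_le_ofReal h4
      _ ≤ (∫⁻ y in Ioo 0 b, ‖deriv F ((x : ℂ) + (y : ℂ) * I)‖ₑ) ^ 2 := by gcongr; exact h1.trans h2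
      _ ≤ (∫⁻ y in Ioo 0 b, ‖deriv F ((x : ℂ) + (y : ℂ) * I)‖ₑ ^ 2) * ENNReal.ofReal b := h3
      _ = _ := mul_comm _ _
  have hlim : Tendsto (fun ε : ℝ => ENNReal.ofReal (((c (b - ε)).re - (c ε).re) ^ 2)) (𝓝[>] 0)
      (𝓝 (ENNReal.ofReal ((u₁ - u₀) ^ 2))) := by
    have hb' : Tendsto (fun ε : ℝ => b - ε) (𝓝[>] 0) (𝓝[<] b) := by
      refine tendsto_nhdsWithin_of_tendsto_nhds_of_eventually_within _ ?_ ?_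
      · have : Tendsto (fun ε : ℝ => b - ε) (𝓝 0) (𝓝 (b - 0)) := tendsto_const_nhds.sub tendsto_id
        rw [sub_zero] at this
        exact this.mono_left nhdsWithin_le_nhds
      · filter_upwards [self_mem_nhdsWithin] with ε hε
        simp only [mem_Iio]; linarith [mem_Ioi.1 hε]
    have hA : Tendsto (fun ε : ℝ => (c (b - ε)).re) (𝓝[>] 0) (𝓝 u₁) := h1.comp hb'
    exact (ENNReal.continuous_ofReal.tendsto _).comp ((hA.sub h0).pow 2)
  refine le_of_tendsto hlim ?_
  have hmem' : ∀ᶠ ε in 𝓝[>] (0 : ℝ), ε < b / 2 :=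
    mem_nhdsWithin_of_mem_nhds (Iio_mem_nhds (by linarith))
  filter_upwards [self_mem_nhdsWithin, hmem'] with ε hε hε'
  exact hbound ε hε hε'

/-- **The rectangle energy inequality, horizontal sides.** If `F` is holomorphic on `(0,a)×(0,b)`
and on every vertical line `Re F → u₀` at the bottom and `→ u₁` at the top, then
`(u₁ - u₀)² a / b ≤ ∬ ‖F'‖²`. [cite: Ahlfors1973CI, §4-2 p. 53] -/
theorem ofReal_sq_sub_mul_div_le_lintegral_rect {a b : ℝ} (ha : 0 < a) (hb : 0 < b) {F : ℂ → ℂ}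
    (hF : DifferentiableOn ℂ F (Ioo 0 a ×ℂ Ioo 0 b)) {u₀ u₁ : ℝ}
    (h0 : ∀ x ∈ Ioo (0 : ℝ) a, Tendsto (fun y : ℝ => (F (x + y * I)).re) (𝓝[>] 0) (𝓝 u₀))
    (h1 : ∀ x ∈ Ioo (0 : ℝ) a, Tendsto (fun y : ℝ => (F (x + y * I)).re) (𝓝[<] b) (𝓝 u₁)) :
    ENNReal.ofReal ((u₁ - u₀) ^ 2 * a / b) ≤ ∫⁻ z in Ioo 0 a ×ℂ Ioo 0 b, ‖deriv F z‖ₑ ^ 2 := by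
  have hmeas : Measurable fun z => ‖deriv F z‖ₑ ^ 2 := (measurable_deriv F).enorm.pow_const 2
  have hsw : AEMeasurable (Function.uncurry fun (y : ℝ) (x : ℝ) => ‖deriv F ((x : ℂ) + (y : ℂ) * I)‖ₑ ^ 2)
      ((volume.restrict (Ioo (0 : ℝ) b)).prod (volume.restrict (Ioo (0 : ℝ) a))) :=
    (hmeas.comp (by fun_prop : Measurable fun p : ℝ × ℝ => (p.2 : ℂ) + (p.1 : ℂ) * I)).aemeasurable
  rw [ExtremalLength.lintegral_rectangle_eq hmeas, lintegral_lintegral_swap hsw]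
  have hline : ∀ x ∈ Ioo (0 : ℝ) a, ENNReal.ofReal ((u₁ - u₀) ^ 2 / b) ≤
      ∫⁻ y in Ioo 0 b, ‖deriv F ((x : ℂ) + (y : ℂ) * I)‖ₑ ^ 2 := by
    intro x hx
    have h := ofReal_sq_sub_le_mul_lintegral_vline hb hF hx (h0 x hx) (h1 x hx)
    have hb' : ENNReal.ofReal b ≠ 0 := (ENNReal.ofReal_pos.2 hb).ne'
    rw [ENNReal.ofReal_div_of_pos hb]
    refine (ENNReal.div_le_iff hb' ENNReal.ofReal_ne_top).2 ?_
    rwa [mul_comm] at h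
  calc ENNReal.ofReal ((u₁ - u₀) ^ 2 * a / b) = ∫⁻ _ in Ioo (0 : ℝ) a, ENNReal.ofReal ((u₁ - u₀) ^ 2 / b) := by
        rw [setLIntegral_const, Real.volume_Ioo, sub_zero, ← ENNReal.ofReal_mul' ha.le]
        congr 1; ring
    _ ≤ ∫⁻ x in Ioo (0 : ℝ) a, ∫⁻ y in Ioo 0 b, ‖deriv F ((x : ℂ) + (y : ℂ) * I)‖ₑ ^ 2 :=
        setLIntegral_mono' measurableSet_Ioo fun x hx => hline x hx

end RectangleEnergyH
/-! ### §B7. The lower bound: subsequential limits of the conductances are at most `1 / d_Ω(T, B)` -/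

section LowerBound

open WeakBeurling MeasureTheory Literature.Analysis.Complex Complex

set_option maxHeartbeats 3200000 in
open Classical in
/-- **[GP19] Theorem 4.6 + the duality argument, lower half**: along any subsequence of the
dyadic meshes with `𝒞(T_n ↔ B_n) → I` we have `I ≤ d_Ω(T, B)⁻¹`; hence
`lim inf_n R^eff_n ≥ d_Ω(T, B)`. Proof (on `ℤ²`, without planar duality): extract the holomorphic
limit `f = u + iv` of the conjugate pairs (`exists_holomorphic_limit`, `∫∫_Ω ‖f'‖² ≤ I`); the
flux across the crosscut identifies the jump of the boundary values of `u` between the open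
arcs `1` and `3` with `±I` (`exists_exits_flux_eq`, `exists_boundary_value`,
`sum_divAt_eq_toReal_conductance`); transporting to the uniformizing rectangle
(`exists_rect_uniformizer`, `lintegral_deriv_comp_sq_eq`) the rectangle energy inequality
(`ofReal_sq_sub_mul_div_le_lintegral_rect`) gives `I² · a/b ≤ I`, and `d_Ω(arc 0, arc 2) ≤ a/b`
(`extremalDistance_arc_le`). [cite: GeorgakopoulosPanagiotis2019, Theorem 4.6 and Corollary 4.15] -/
theorem le_inv_extremalDistance_of_subseq (R : RandomPlanarGeometry.ConformalRectangle)
    (h0 : (0 : ℂ) ∈ R.carrier) (hsep : ∀ n : ℕ, OppositeArcsSeparated R ((2 : ℝ)⁻¹ ^ n))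
    {k : ℕ → ℕ} (hk : StrictMono k) {I : ℝ≥0∞}
    (hI : Tendsto (fun n => effectiveConductance (domainGraph R.carrier ((2 : ℝ)⁻¹ ^ k n)) 1
      (arcVertices R.carrier ((2 : ℝ)⁻¹ ^ k n) (R.arc 0))
      (arcVertices R.carrier ((2 : ℝ)⁻¹ ^ k n) (R.arc 2))) atTop (𝓝 I)) :
    I ≤ (Literature.Analysis.Complex.extremalDistance R.carrier (R.arc 0) (R.arc 2))⁻¹ := by
  have hΩo : IsOpen R.carrier := R.isOpen
  have hfrΩ : ∀ z ∈ frontier R.carrier, z ∉ R.carrier := fun z hz hzΩ =>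
    Set.disjoint_left.1 R.disjoint_carrier_frontier hzΩ hz
  -- ### Step 0: `I` is finite
  obtain ⟨K, hK⟩ := eventually_effectiveConductance_le R
  have hCK : ∀ᶠ n in atTop, effectiveConductance (domainGraph R.carrier ((2 : ℝ)⁻¹ ^ k n)) 1
      (arcVertices R.carrier ((2 : ℝ)⁻¹ ^ k n) (R.arc 0)) (arcVertices R.carrier ((2 : ℝ)⁻¹ ^ k n) (R.arc 2)) ≤ K :=
    hk.tendsto_atTop.eventually hK
  have hIK : I ≤ K := le_of_tendsto hI hCK
  have hItop : I ≠ ⊤ := ne_top_of_le_ne_top ENNReal.coe_ne_top hIK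
  set Ir : ℝ := I.toReal with hIrdef
  have hIr : I = ENNReal.ofReal Ir := (ENNReal.ofReal_toReal hItop).symm
  have hIr0 : 0 ≤ Ir := ENNReal.toReal_nonneg
  -- ### Step 1: the uniformizing rectangle
  obtain ⟨a, b, ha, hb, Ψ, jL, jR, hΨc, hΨinj, hΨcl, hΨimg, hΨd, hΨ', hLR, hLcl, hRcl, hLo, hRo, hBo, hTo⟩ := exists_rect_uniformizer R
  have hlam : Literature.Analysis.Complex.extremalDistance R.carrier (R.arc 0) (R.arc 2) ≤ ENNReal.ofReal (a / b) :=
    extremalDistance_arc_le R ha hb hΨc hΨinj hΨimg hΨd hLR hLcl hRcl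
  -- ### Step 2: the cross
  obtain ⟨ΓV, ΓH, c₀, r, xs, ys, tᵢ, tₒ, sᵢ, sₒ, hVc, hHc, hV0, hV1, hH0, hH1, hVΩ, hHΩ, hmeet, -, -, hVarc, hr, hball,
    htᵢ, htᵢ', htₒ', htₒ, hsᵢ, hsᵢ', hsₒ', hsₒ, hnVi, hnVo, hnHi, hnHo, houtV1, houtV2, houtH1, houtH2, hclVi, hclVo, hclHi, hclHo,
    hxs, hys, -, -⟩ := exists_cross_data R ha hb hΨc hΨinj hΨimg hΨd hΨ' hLo hRo hBo hTo
  have hc : (⟨xs, ys⟩ : ℂ) ∈ R.carrier := by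
    refine hball (mem_closedBall.2 ?_)
    rw [Complex.dist_eq]
    refine (Complex.norm_le_abs_re_add_abs_im _).trans ?_
    have e1 : ((⟨xs, ys⟩ : ℂ) - c₀).re = xs - c₀.re := by simp
    have e2 : ((⟨xs, ys⟩ : ℂ) - c₀).im = ys - c₀.im := by simp
    rw [e1, e2]
    linarith [hxs.le, hys.le]
  -- ### Step 3: separation of the pieces
  obtain ⟨hdisjA, hdisjB, hA234, hB234⟩ := cross_separation hmeet hr htᵢ htᵢ' htₒ' htₒ hsᵢ hsᵢ' hsₒ' hsₒ hnVi hnVo hnHi hnHo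
    houtV1 houtV2 houtH1 houtH2 hclVi hclVo hclHi hclHo hxs hys
  -- ### Step 4: exterior closing curves
  have hqbfr : ΓV 0 ∈ frontier R.carrier := R.arc_subset_frontier 1 (openArc_subset_arc R 1 hV0)
  have hqtfr : ΓV 1 ∈ frontier R.carrier := R.arc_subset_frontier 3 (openArc_subset_arc R 3 hV1)
  obtain ⟨Et, Eb, M, hEtc, hEbc, hMc, hEt1, hEb1, hEt, hEb, hM, hM0, hM1⟩ :=
    exists_exterior_curves R.toJordanDomain hqtfr hqbfr
  -- ### Step 5: the holomorphic limit
  obtain ⟨h, hprops, φ, hφ, f, hfd, hfint, hfconv⟩ := exists_holomorphic_limit R h0 hsep hk hI hc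
  set δs : ℕ → ℝ := fun n => (2 : ℝ)⁻¹ ^ k (φ n) with hδs
  have hδ : ∀ n, 0 < δs n := fun n => by positivity
  have hδ0 : Tendsto δs atTop (𝓝 0) :=
    (tendsto_pow_atTop_nhds_zero_of_lt_one (by norm_num) (by norm_num)).comp (hk.comp hφ).tendsto_atTop
  have hT := fun n => (hprops (φ n)).1
  have hB := fun n => (hprops (φ n)).2.1
  have h01 := fun n => (hprops (φ n)).2.2.1
  have hE := fun n => (hprops (φ n)).2.2.2.1
  have hharm := fun n => (hprops (φ n)).2.2.2.2
  have hCφ : Tendsto (fun n => effectiveConductance (domainGraph R.carrier (δs n)) 1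
      (arcVertices R.carrier (δs n) (R.arc 0)) (arcVertices R.carrier (δs n) (R.arc 2))) atTop (𝓝 I) := hI.comp hφ.tendsto_atTop
  have hCφr : Tendsto (fun n => (effectiveConductance (domainGraph R.carrier (δs n)) 1
      (arcVertices R.carrier (δs n) (R.arc 0)) (arcVertices R.carrier (δs n) (R.arc 2))).toReal) atTop (𝓝 Ir) :=
    (ENNReal.tendsto_toReal hItop).comp hCφ
  -- ### Step 6: the energies are eventually bounded
  have hEn : ∀ᶠ n in atTop, ∑ e ∈ (edgeSet_domainGraph_finite R.isBounded (hδ n)).toFinset, sqIncr (h (φ n)) e ≤ (K : ℝ) := by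
    filter_upwards [hφ.tendsto_atTop.eventually hCK] with n hn
    have h1 : ENNReal.ofReal (∑ e ∈ (edgeSet_domainGraph_finite R.isBounded (hδ n)).toFinset, sqIncr (h (φ n)) e) ≤
        networkEnergy (domainGraph R.carrier (δs n)) 1 (h (φ n)) := by
      have := ofReal_sum_le_networkEnergy (G := domainGraph R.carrier (δs n)) (c := 1) (h (φ n))
        (S := (edgeSet_domainGraph_finite R.isBounded (hδ n)).toFinset) (fun e he => (Set.Finite.mem_toFinset _).1 he)
      simpa using this
    rw [hE n] at h1
    have h2 := h1.trans hn
    have hsum0 : 0 ≤ ∑ e ∈ (edgeSet_domainGraph_finite R.isBounded (hδ n)).toFinset, sqIncr (h (φ n)) e :=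
      Finset.sum_nonneg fun e _ => sqIncr_nonneg _ _
    exact (ENNReal.ofReal_le_iff_le_toReal ENNReal.coe_ne_top).1 h2 |>.trans (by simp)
  -- ### Step 7: boundary values (`exists_boundary_value`)
  have hD10 := fun (D : ℝ) (hD : 0 < D) => exists_boundary_value R h0 hδ hδ0 (h := fun n => h (φ n)) h01 hharm hEn hc
    (u := fun w => (f w).re) hfconv hD
  -- ### Step 8: the boundary values are constant along the open arcs `1` and `3`
  set arcs : Set ℂ := R.arc 0 ∪ R.arc 2 with harcs
  have harcs_closed : IsClosed arcs := (R.isClosed_arc 0).union (R.isClosed_arc 2)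
  have harcs_ne : arcs.Nonempty := ⟨R.pt 0, Or.inl (R.pt_mem_arc_self 0)⟩
  -- boundary points of the open arcs `1`, `3` are off `arcs`
  have hoff : ∀ i : Fin 4, (i = 1 ∨ i = 3) → ∀ s ∈ Ioo (R.mark i) (R.nextMark i), R.boundary s ∉ arcs := by
    intro i hi s hs hmem
    have hq : R.boundary s ∈ openArc R i := ⟨s, hs, rfl⟩
    rcases hmem with h' | h'
    · exact Set.disjoint_left.1 (openArc_disjoint_arc R (i := i) (j := 0) (by rcases hi with rfl | rfl <;> decide)) hq h'
    · exact Set.disjoint_left.1 (openArc_disjoint_arc R (i := i) (j := 2) (by rcases hi with rfl | rfl <;> decide)) hq h'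
  have hDpos : ∀ {q : ℂ}, q ∉ arcs → 0 < infDist q arcs := fun hq =>
    (infDist_pos_iff_notMem_closure harcs_ne).1 (by rwa [harcs_closed.closure_eq])
  -- the boundary-limit predicate and the limit function
  set P : ℂ → ℝ → Prop := fun q U => ∀ η > 0, ∃ r > 0, ∀ w ∈ R.carrier, dist w q < r → |(f w).re - U| ≤ η with hP
  have hPex : ∀ {s : ℝ}, R.boundary s ∉ arcs → ∃ U, P (R.boundary s) U := by
    intro s hs
    obtain ⟨ra, -, hra⟩ := hD10 _ (hDpos hs)
    obtain ⟨U, c, -, hbv, -, -⟩ := hra s fun y hy => infDist_le_dist_of_mem hy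
    exact ⟨U, hbv⟩
  set Ulim : ℂ → ℝ := fun q => if hq : ∃ U, P q U then Classical.choose hq else 0 with hUlim
  have hUlimP : ∀ {s : ℝ}, R.boundary s ∉ arcs → P (R.boundary s) (Ulim (R.boundary s)) := by
    intro s hs
    have hex := hPex hs
    simp only [hUlim, dif_pos hex]
    exact Classical.choose_spec hex
  have hcl : ∀ s : ℝ, R.boundary s ∈ closure R.carrier := fun s => frontier_subset_closure (R.boundary_mem_frontier s)
  have hUuniq : ∀ {s : ℝ} {U : ℝ}, R.boundary s ∉ arcs → P (R.boundary s) U → U = Ulim (R.boundary s) :=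
    fun hs hU => boundaryLimit_unique (hcl _) hU (hUlimP hs)
  -- local constancy along an open arc off `arcs`
  have hloc : ∀ i : Fin 4, (i = 1 ∨ i = 3) → ∀ s₀ ∈ Ioo (R.mark i) (R.nextMark i), ∃ ε > 0,
      ∀ s ∈ Ioo (R.mark i) (R.nextMark i), |s - s₀| < ε → Ulim (R.boundary s) = Ulim (R.boundary s₀) := by
    intro i hi s₀ hs₀
    set q₀ := R.boundary s₀ with hq₀
    have hq₀off := hoff i hi s₀ hs₀
    have hD₀ := hDpos hq₀off
    set D : ℝ := infDist q₀ arcs / 2 with hDdef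
    obtain ⟨ra, hra, hbvD⟩ := hD10 D (by positivity)
    -- continuity of the boundary curve at `s₀`
    obtain ⟨ε, hε, hεc⟩ := Metric.continuousAt_iff.1 (R.continuous_boundary.continuousAt (x := s₀)) (min (ra / 2) D) (by positivity)
    refine ⟨ε, hε, fun s hs hss₀ => ?_⟩
    have hd : dist (R.boundary s) q₀ < min (ra / 2) D := hεc (by rwa [Real.dist_eq])
    have hdra : dist (R.boundary s) q₀ < ra / 2 := hd.trans_le (min_le_left _ _)
    have hdD : dist (R.boundary s) q₀ < D := hd.trans_le (min_le_right _ _)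
    have hsoff := hoff i hi s hs
    -- the `D`-separation at `s₀` and at `s`
    have hsep₀ : ∀ y ∈ arcs, D ≤ dist q₀ y := fun y hy => by
      have := infDist_le_dist_of_mem (x := q₀) hy; rw [hDdef]; linarith [hD₀]
    have hseps : ∀ y ∈ arcs, D ≤ dist (R.boundary s) y := fun y hy => by
      have h1 := infDist_le_dist_of_mem (x := q₀) hy
      have h2 := dist_triangle q₀ (R.boundary s) y
      rw [dist_comm q₀ (R.boundary s)] at h2
      rw [hDdef] at hdD ⊢; linarith
    obtain ⟨U₀, c₀', hc₀', hbv₀, h3₀, -⟩ := hbvD s₀ hsep₀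
    obtain ⟨Us, cs, hcs, hbvs, -, h4s⟩ := hbvD s hseps
    -- eventually `cs n = c₀' n`
    have heq : ∀ᶠ n in atTop, cs n = c₀' n := by
      filter_upwards [h3₀, h4s] with n h3 h4
      obtain ⟨p, p', hpF, hpp', hp'F, ⟨j, hjsq, hjfr, hjq⟩, hval⟩ := h4
      rw [← hval]
      refine h3 p p' hpF hpp' hp'F ⟨j, hjsq, hjfr, ?_⟩
      linarith [dist_triangle j (R.boundary s) q₀]
    have hUeq : Us = U₀ := tendsto_nhds_unique hcs (hc₀'.congr' (heq.mono fun n hn => hn.symm))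
    rw [← hUuniq hsoff hbvs, ← hUuniq hq₀off hbv₀, hUeq]
  have hconst : ∀ i : Fin 4, (i = 1 ∨ i = 3) → ∀ s ∈ Ioo (R.mark i) (R.nextMark i), ∀ s' ∈ Ioo (R.mark i) (R.nextMark i),
      Ulim (R.boundary s) = Ulim (R.boundary s') := fun i hi s hs s' hs' =>
    eq_of_locallyConstant_Ioo (g := fun s => Ulim (R.boundary s)) (hloc i hi) hs hs'
  -- ### Step 8b: the jump across the crosscut
  obtain ⟨sb, hsb, hqb⟩ := hV0
  obtain ⟨st, hst, hqt⟩ := hV1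
  set Ubot : ℝ := Ulim (ΓV 0) with hUbot
  set Utop : ℝ := Ulim (ΓV 1) with hUtop
  have hqboff : ΓV 0 ∉ arcs := by rw [← hqb]; exact hoff 1 (Or.inl rfl) sb hsb
  have hqtoff : ΓV 1 ∉ arcs := by rw [← hqt]; exact hoff 3 (Or.inr rfl) st hst
  obtain ⟨rab, hrab, hbvb⟩ := hD10 _ (hDpos hqboff)
  obtain ⟨rat, hrat, hbvt⟩ := hD10 _ (hDpos hqtoff)
  obtain ⟨Ub, cb, hcb, hbvb', h3b, -⟩ := hbvb sb (by rw [hqb]; exact fun y hy => infDist_le_dist_of_mem hy)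
  obtain ⟨Ut, ct, hct, hbvt', h3t, -⟩ := hbvt st (by rw [hqt]; exact fun y hy => infDist_le_dist_of_mem hy)
  have hUb : Ub = Ubot := by rw [hUbot, ← hqb]; exact hUuniq (by rw [hqb]; exact hqboff) hbvb'
  have hUt : Ut = Utop := by rw [hUtop, ← hqt]; exact hUuniq (by rw [hqt]; exact hqtoff) hbvt'
  -- the exits of the crosscut loop
  obtain ⟨δ₀, hδ₀pos, hflux⟩ := exists_exits_flux_eq R h0 hVc hHc ⟨sb, hsb, hqb.symm⟩ ⟨st, hst, hqt.symm⟩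
    (by obtain ⟨σ, hσ, e⟩ := hH0; exact ⟨σ, hσ, e.symm⟩) (by obtain ⟨σ, hσ, e⟩ := hH1; exact ⟨σ, hσ, e.symm⟩) hLR hVΩ hHΩ hr hball
    htᵢ (htᵢ'.trans htₒ') htₒ hsᵢ (hsᵢ'.trans hsₒ') hsₒ hxs hys hdisjA hdisjB hA234 hB234 hVarc hEtc hEbc hMc hEt1 hEb1 hEt hEb hM hM0 hM1
    (η := min rab rat / 2) (by positivity)
  have hjump : ∀ᶠ n in atTop, ct n - cb n = (if jL = 0 then (1 : ℝ) else -1) *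
      (effectiveConductance (domainGraph R.carrier (δs n)) 1 (arcVertices R.carrier (δs n) (R.arc 0)) (arcVertices R.carrier (δs n) (R.arc 2))).toReal := by
    filter_upwards [h3b, h3t, (tendsto_order.1 hδ0).2 _ (lt_min hδ₀pos (by positivity : (0 : ℝ) < min rab rat / 8))] with n h3b' h3t' hn
    have hnδ₀ : δs n < δ₀ := hn.trans_le (min_le_left _ _)
    have hn8 : δs n < min rab rat / 8 := hn.trans_le (min_le_right _ _)
    have hfin : (arcVertices R.carrier (δs n) (R.arc 0)).Finite := (domain_finite R.isBounded (hδ n)).subset fun x hx => hx.1.1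
    have hdisj := disjoint_arcVertices_of_oppositeArcsSeparated R (hsep (k (φ n)))
    obtain ⟨hbase, pb, nb, pt, nt, hpbnb, hptnt, hpbF, hptF, hnbF, hntF, ⟨wb, hwb, hwbd⟩, ⟨wt, hwt, hwtd⟩, hval⟩ :=
      hflux (δs n) (hδ n) hnδ₀ (h (φ n)) hfin hdisj (hharm n)
    rw [sum_divAt_eq_toReal_conductance R (hδ n) (hT n) (hB n) (hE n) (hharm n) hfin] at hval
    -- the exits are exits near `ΓV 0`, `ΓV 1`
    have hinner : ∀ {q : Site 2}, (dualGraph R.carrier (δs n)).Reachable ![⌊xs / δs n⌋, ⌊ys / δs n⌋] q → IsInnerSq R.carrier (δs n) q :=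
      fun hq => by obtain ⟨W⟩ := hq; exact isInnerSq_of_mem_support' hbase W (Walk.end_mem_support _)
    have hnotinner : ∀ {p q : Site 2}, (dualGraph R.carrier (δs n)).Reachable ![⌊xs / δs n⌋, ⌊ys / δs n⌋] p →
        (zdGraph 2).Adj p q → ¬ (dualGraph R.carrier (δs n)).Reachable ![⌊xs / δs n⌋, ⌊ys / δs n⌋] q → ¬ IsInnerSq R.carrier (δs n) q :=
      fun hp hpq hq hqI => hq (hp.trans (dualGraph_adj_iff.2 ⟨hpq, hinner hp, hqI⟩).reachable)
    obtain ⟨jb, hjbsq, hjbfr⟩ := exists_mem_frontier_of_adj_not_isInnerSq R (hδ n) (hinner hpbF) hpbnb (hnotinner hpbF hpbnb hnbF)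
    obtain ⟨jt, hjtsq, hjtfr⟩ := exists_mem_frontier_of_adj_not_isInnerSq R (hδ n) (hinner hptF) hptnt (hnotinner hptF hptnt hntF)
    have hvb : exitVal R.carrier (δs n) (h (φ n)) ![⌊xs / δs n⌋, ⌊ys / δs n⌋] pb nb = cb n := by
      refine h3b' pb nb hpbF hpbnb hnbF ⟨jb, hjbsq, hjbfr, ?_⟩
      rw [hqb]
      have := dist_le_of_mem_closedSq hjbsq hwb
      linarith [dist_triangle jb wb (ΓV 0), min_le_left rab rat]
    have hvt : exitVal R.carrier (δs n) (h (φ n)) ![⌊xs / δs n⌋, ⌊ys / δs n⌋] pt nt = ct n := by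
      refine h3t' pt nt hptF hptnt hntF ⟨jt, hjtsq, hjtfr, ?_⟩
      rw [hqt]
      have := dist_le_of_mem_closedSq hjtsq hwt
      linarith [dist_triangle jt wt (ΓV 1), min_le_right rab rat]
    rw [← hvb, ← hvt, hval]
  have hUdiff : Utop - Ubot = (if jL = 0 then (1 : ℝ) else -1) * Ir := by
    rw [← hUb, ← hUt]
    refine tendsto_nhds_unique (hct.sub hcb) ?_
    exact (hCφr.const_mul _).congr' (hjump.mono fun n hn => hn.symm)
  have hUsq : (Utop - Ubot) ^ 2 = Ir ^ 2 := by
    rw [hUdiff]; split_ifs <;> ring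
  -- ### Step 9: boundary values of `F = f ∘ Ψ` on the horizontal sides
  set F : ℂ → ℂ := f ∘ Ψ with hF
  have hrect_sub : Ioo 0 a ×ℂ Ioo (0 : ℝ) b ⊆ Icc 0 a ×ℂ Icc 0 b := fun z hz => by
    rw [mem_reProdIm] at hz ⊢; exact ⟨Ioo_subset_Icc_self hz.1, Ioo_subset_Icc_self hz.2⟩
  have hside : ∀ x ∈ Ioo (0 : ℝ) a, ∀ (y₀ : ℝ), (y₀ = 0 ∨ y₀ = b) → ∀ U : ℝ, P (Ψ ((x : ℂ) + (y₀ : ℂ) * Complex.I)) U →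
      ∀ ε > 0, ∃ θ > 0, ∀ y ∈ Ioo (0 : ℝ) b, |y - y₀| < θ → dist ((F ((x : ℂ) + (y : ℂ) * Complex.I)).re) U < ε := by
    intro x hx y₀ hy₀ U hPU ε hε
    obtain ⟨r, hr, hrU⟩ := hPU (ε / 2) (by positivity)
    have hmem₀ : (x : ℂ) + (y₀ : ℂ) * Complex.I ∈ Icc 0 a ×ℂ Icc (0 : ℝ) b := by
      rw [mem_reProdIm]; simp only [add_re, ofReal_re, mul_re, I_re, mul_zero, ofReal_im, I_im, mul_one, sub_self, add_zero,
        add_im, mul_im, zero_add]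
      exact ⟨Ioo_subset_Icc_self hx, by rcases hy₀ with rfl | rfl <;> [exact ⟨le_rfl, hb.le⟩; exact ⟨hb.le, le_rfl⟩]⟩
    obtain ⟨θ, hθ, hθc⟩ := Metric.continuousWithinAt_iff.1 (hΨc _ hmem₀) r hr
    refine ⟨θ, hθ, fun y hy hyy₀ => ?_⟩
    have hmem : (x : ℂ) + (y : ℂ) * Complex.I ∈ Ioo 0 a ×ℂ Ioo (0 : ℝ) b := by
      rw [mem_reProdIm]; simpa using ⟨hx, hy⟩
    have hΩmem : Ψ ((x : ℂ) + (y : ℂ) * Complex.I) ∈ R.carrier := by rw [← hΨimg]; exact mem_image_of_mem Ψ hmem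
    have hd : dist ((x : ℂ) + (y : ℂ) * Complex.I) ((x : ℂ) + (y₀ : ℂ) * Complex.I) < θ := by
      rw [dist_eq_norm, show (x : ℂ) + (y : ℂ) * Complex.I - ((x : ℂ) + (y₀ : ℂ) * Complex.I) = ((y - y₀ : ℝ) : ℂ) * Complex.I by push_cast; ring,
        norm_mul, norm_I, mul_one, norm_real, Real.norm_eq_abs]
      exact hyy₀
    have := hrU _ hΩmem (hθc (hrect_sub hmem) hd)
    rw [Real.dist_eq]
    exact lt_of_le_of_lt this (by linarith)
  have hbot : ∀ x ∈ Ioo (0 : ℝ) a, Tendsto (fun y : ℝ => (F ((x : ℂ) + (y : ℂ) * Complex.I)).re) (𝓝[>] 0) (𝓝 Ubot) := by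
    intro x hx
    have hq : Ψ ((x : ℂ) + ((0 : ℝ) : ℂ) * Complex.I) ∈ openArc R 1 := by
      refine hBo (mem_image_of_mem Ψ ?_)
      rw [mem_reProdIm]; simpa using hx
    obtain ⟨sx, hsx, hqx⟩ := hq
    have hoffx := hoff 1 (Or.inl rfl) sx hsx
    have hPx : P (Ψ ((x : ℂ) + ((0 : ℝ) : ℂ) * Complex.I)) Ubot := by
      rw [← hqx, hUbot, ← hqb, ← hconst 1 (Or.inl rfl) sx hsx sb hsb]; exact hUlimP hoffx
    rw [Metric.tendsto_nhdsWithin_nhds]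
    intro ε hε
    obtain ⟨θ, hθ, hθU⟩ := hside x hx 0 (Or.inl rfl) Ubot hPx ε hε
    refine ⟨min θ b, by positivity, fun y hy hyd => hθU y ⟨hy, ?_⟩ ?_⟩
    · rw [Real.dist_eq, sub_zero, abs_of_pos hy] at hyd; exact hyd.trans_le (min_le_right _ _)
    · rw [Real.dist_eq] at hyd; exact hyd.trans_le (min_le_left _ _)
  have htop : ∀ x ∈ Ioo (0 : ℝ) a, Tendsto (fun y : ℝ => (F ((x : ℂ) + (y : ℂ) * Complex.I)).re) (𝓝[<] b) (𝓝 Utop) := by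
    intro x hx
    have hq : Ψ ((x : ℂ) + ((b : ℝ) : ℂ) * Complex.I) ∈ openArc R 3 := by
      refine hTo (mem_image_of_mem Ψ ?_)
      rw [mem_reProdIm]; simpa using hx
    obtain ⟨sx, hsx, hqx⟩ := hq
    have hoffx := hoff 3 (Or.inr rfl) sx hsx
    have hPx : P (Ψ ((x : ℂ) + ((b : ℝ) : ℂ) * Complex.I)) Utop := by
      rw [← hqx, hUtop, ← hqt, ← hconst 3 (Or.inr rfl) sx hsx st hst]; exact hUlimP hoffx
    rw [Metric.tendsto_nhdsWithin_nhds]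
    intro ε hε
    obtain ⟨θ, hθ, hθU⟩ := hside x hx b (Or.inr rfl) Utop hPx ε hε
    refine ⟨min θ b, by positivity, fun y hy hyd => hθU y ⟨?_, hy⟩ ?_⟩
    · rw [Real.dist_eq, abs_sub_comm, abs_of_pos (by simpa using hy)] at hyd
      linarith [min_le_right θ b]
    · rw [Real.dist_eq] at hyd; exact hyd.trans_le (min_le_left _ _)
  -- ### Step 10: the rectangle energy inequality and the change of variables
  have hopen : IsOpen (Ioo 0 a ×ℂ Ioo (0 : ℝ) b) := isOpen_Ioo.reProdIm isOpen_Ioo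
  have hFd : DifferentiableOn ℂ F (Ioo 0 a ×ℂ Ioo 0 b) :=
    hfd.comp hΨd fun z hz => by rw [← hΨimg]; exact mem_image_of_mem Ψ hz
  have hE2 := ofReal_sq_sub_mul_div_le_lintegral_rect ha hb hFd hbot htop
  have hcov : ∫⁻ z in Ioo 0 a ×ℂ Ioo 0 b, ‖deriv F z‖ₑ ^ 2 = ∫⁻ w in R.carrier, ‖deriv f w‖ₑ ^ 2 := by
    have := lintegral_deriv_comp_sq_eq (f := f) hopen hΨd (hΨinj.mono hrect_sub) (by rw [hΨimg]; exact hΩo) (by rw [hΨimg]; exact hfd)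
    rwa [hΨimg] at this
  rw [hUsq, hcov] at hE2
  have hfinal : ENNReal.ofReal (Ir ^ 2 * a / b) ≤ ENNReal.ofReal Ir := by rw [← hIr]; exact hE2.trans hfint
  -- ### Step 11: conclusion
  have hIrle : Ir ≤ b / a := by
    rw [ENNReal.ofReal_le_ofReal_iff hIr0] at hfinal
    rcases hIr0.eq_or_lt with h0' | hpos
    · rw [← h0']; positivity
    · have h1 : Ir * (Ir * a / b) ≤ Ir * 1 := by rw [mul_one]; calc Ir * (Ir * a / b) = Ir ^ 2 * a / b := by ring
        _ ≤ Ir := hfinal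
      have h2 : Ir * a / b ≤ 1 := le_of_mul_le_mul_left h1 hpos
      rw [div_le_one hb] at h2
      rw [le_div_iff₀ ha]; linarith
  calc I = ENNReal.ofReal Ir := hIr
    _ ≤ ENNReal.ofReal (b / a) := ENNReal.ofReal_le_ofReal hIrle
    _ = (ENNReal.ofReal (a / b))⁻¹ := by
        rw [← ENNReal.ofReal_inv_of_pos (by positivity : (0 : ℝ) < a / b), inv_div]
    _ ≤ (Literature.Analysis.Complex.extremalDistance R.carrier (R.arc 0) (R.arc 2))⁻¹ := ENNReal.inv_le_inv.2 hlam

/-! ### §B8. [GP19] Corollary 4.15 -/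

/-- **[GP19] Corollary 4.15** (A. Georgakopoulos, C. Panagiotis, *Convergence of square tilings to
the Riemann map*, arXiv:1910.06886, Cor. 4.15, p. 16: "`R^eff_n → m`, the extremal length /
conformal modulus of `(Ω; T, B)`"): for a conformal rectangle `Ω ∋ 0` discretised along the
dyadic meshes, the effective resistances between `T_n` and `B_n` in `Ω_n` converge to the
extremal distance `d_Ω(T, B)` of the two opposite arcs. Proof: `lim sup ≤` is
`SquareTiling.limsup_effectiveResistance_le_extremalDistance` (Theorem 4.6 for the potentials,
`…Limsup.lean`), `lim inf ≥` is `SquareTiling.le_inv_extremalDistance_of_subseq` (the conjugates;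
this file); every subsequential limit of the conductances in the compact `ℝ≥0∞` is thus
`d_Ω(T,B)⁻¹`. [cite: GeorgakopoulosPanagiotis2019, Corollary 4.15] -/
theorem _root_.Literature.Probability.LatticeModels.GeorgakopoulosPanagiotis2019_cor415_holds :
    GeorgakopoulosPanagiotis2019_cor415 := by
  intro R h0 hsep
  set lam := Literature.Analysis.Complex.extremalDistance R.carrier (R.arc 0) (R.arc 2) with hlam
  set C : ℕ → ℝ≥0∞ := fun n => effectiveConductance (domainGraph R.carrier ((2 : ℝ)⁻¹ ^ n)) 1
    (arcVertices R.carrier ((2 : ℝ)⁻¹ ^ n) (R.arc 0)) (arcVertices R.carrier ((2 : ℝ)⁻¹ ^ n) (R.arc 2)) with hC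
  -- the conductances converge to `lam⁻¹`
  have hCt : Tendsto C atTop (𝓝 lam⁻¹) := by
    refine tendsto_of_subseq_tendsto fun ns hns => ?_
    obtain ⟨ψ₁, hψ₁, hmono⟩ := strictMono_subseq_of_tendsto_atTop hns
    obtain ⟨J, ψ₂, hψ₂, hJ⟩ := SeqCompactSpace.tendsto_subseq (fun n => C (ns (ψ₁ n)))
    have hk : StrictMono (ns ∘ ψ₁ ∘ ψ₂) := hmono.comp hψ₂
    have hJ' : Tendsto (fun n => C ((ns ∘ ψ₁ ∘ ψ₂) n)) atTop (𝓝 J) := hJ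
    have h1 : J ≤ lam⁻¹ := le_inv_extremalDistance_of_subseq R h0 hsep hk hJ'
    have h2 : lam⁻¹ ≤ J := inv_extremalDistance_le_of_subseq R h0 hsep hk hJ'
    exact ⟨ψ₁ ∘ ψ₂, by rw [le_antisymm h1 h2] at hJ'; exact hJ'⟩
  -- invert
  have : Tendsto (fun n => (C n)⁻¹) atTop (𝓝 (lam⁻¹)⁻¹) := (tendsto_inv_iff).2 hCt
  rw [inv_inv] at this
  exact this

end LowerBound


end SquareTiling

end Literature.Probability.LatticeModels
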